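import Literature.Analysis.FluidPDE.LocalizedHybridDirectionStretching
import HarnessLib

/-!
# The localized stretching estimate with the coherence of the vorticity direction as a WEIGHT
# on the convolution variable (Grujić–Guberović 2010, Thm. 2: the estimate of the leading
# vortex-stretching term `J` on one parabolic cylinder)

Analysis/FluidPDE proof file (theorems only: no definition, no named fact, no `sorry`), second
brick of the discharge of `Literature.Analysis.FluidPDE.grujicGuberovic2010_coherenceWeighted_criterion`
(`GrujicGuberovic2010LocalHybridCriteria.lean`; Z. Grujić, R. Guberović, *Localization of analytic
regularity criteria on the vorticity and balance between the vorticity magnitude and coherence of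
the vorticity direction in the 3D NSE*, Comm. Math. Phys. **298** (2010) 407–418, Thm. 2 p. 415,
proof §4 pp. 415–417), and the weighted twin of the tree's localized hybrid stretching estimate
`exists_localized_stretching_le_of_holderExp_of_vorticity_Lr`
(`LocalizedHybridDirectionStretching.lean`; Grujić–Zhang 2006 Thm. 1.1 / Chae 2007 Thm. 1.2).

Grujić–Guberović (§4) bound the leading-order vortex-stretching term by (14),
"`J ≤ c ∫∫ ρ_{γ,2r}(x,t)|ω(x,t)| (∫_{B(x₀,2r)} |(ψω)(y,t)|/|x − y|^{3−γ} dy) |(ψω)(x,t)| dx dt`",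
`ρ_{γ,r}(x,t) = sup_{y ∈ B(x,r), y ≠ x} |sin φ(ξ(x,t), ξ(y,t))|/|x − y|^γ` the `γ`-Hölder measure of
coherence of the vorticity direction (p. 410), and then (pp. 416–417) "Hölder inequality in `x`
with the exponents `α, p₁` and `p₂` … the Hardy–Littlewood–Sobolev inequality …
`p̃ = 3p₁/(3 + γp₁)` … Interpolating the last two factors … Hölder inequality in `t` with the
exponents `2/(γ+3(1−1/α)−1)`, `∞` and `2/(3−γ−3(1−1/α))` … provided `α < 3/γ` and `α > 3/(γ+2)`".

This file proves the corresponding **fixed-time** estimate in the frame of the tree's bricks. The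
one structural observation needed to reuse them: the quotient `|sin φ(ξ(x), ξ(y))|/|x − y|^γ` is
symmetric in `x, y`, so the depletion of the Biot–Savart gradient kernel at `x` is equally dominated
by the coherence measure at the CONVOLUTION point `y`,
`|ω_hi(y) − ⟪ω_hi(y), ξ(x)⟫ξ(x)| ≤ |ω_hi(y)| ρ(y)|x − y|^γ`
(`exists_abs_inner_highPart_fderiv_biotSavart_cutoff_le_holderWeight`, `LocalizedDirectionStretching.lean`);
in that form the weight `ρ|ω|` is the DENSITY of the Riesz potential of order `γ`, and the printed
Hölder / Hardy–Littlewood–Sobolev / interpolation chain is literally that of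
`exists_localized_stretching_le_of_holderExp_of_vorticity_Lr` with (Hölder, Lebesgue) exponents
`(α, r) := (γ, α)`, `θ = 1 + γ/2 − 3/(2α)`, `1/(αθ) = 2/((2+γ)α − 3) = δ` (the scaling-invariance
exponent (6)):

* `exists_localized_stretching_le_of_holderWeight_Lr` — fix a centre `c`, a radius `s > 0`, a weight
  `φ ∈ C¹`, `0 ≤ φ ≤ 1`, `tsupport φ ⊆ B̄(c, s)`, `ν, Ω > 0`, and exponents `0 < α`, `1 < r`,
  `αr < 3`, `1/r < (2+α)/3`, `θ = 1 + α/2 − (3/2)(1/r)`. There are `C₁, …, C₅ ≥ 0` such that for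
  every `V ∈ C²(ℝ³; ℝ³)` divergence free on `B(c, 6s)` and every measurable, nonnegative, bounded
  weight `m` with `√(1 − ⟪ξ(x), ξ(y)⟫²) ≤ m(y)|x − y|^α` for all pairs of points of `B(c, 6s)`
  where `|curl V| > Ω`:
  `2∫φ²⟪ω,(∇V)ω⟫ ≤ ν∫φ²|∇ω|²_F + (C₁ + C₂(Y + F) + C₃E + C₅ (∫_{B̄(c,6s)} (m|ω|)^r)^{1/(rθ)})∫φ²|ω|²
  + C₄(Y + F)`, `ω = curl V`, `Y = ∫_{B̄(c,6s)}|ω|²`, `F = ∫_{B̄(c,6s)}‖∇V‖²`, `E = ∫_{B̄(c,6s)}|V|²`.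

The proof is that of `exists_localized_stretching_le_of_holderExp_of_vorticity_Lr` verbatim (low
terms, integration by parts of the remainder field with the local sup bound
`exists_norm_sub_biotSavart_ballCutoff_le`, Hölder `(p, q')` with `1/q' = 1/r − α/3`,
Hardy–Littlewood–Sobolev from `L^r` — now for the density `m·|χω_hi| ≤ m|ω|` on `B̄(c, 6s)` —,
`L²–L⁶` interpolation of `φω`, Sobolev, Young with exponents `1/(1−θ), 1/θ`); recorded deviation
from print: pointwise-in-time Young instead of the space–time Hölder inequality and absorption for
small `r` (the Grönwall step of the discharge takes `(∫ (m|ω|)^r)^{1/(rθ)} ∈ L¹_t`, which for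
`m = ρ_{γ,2R}` is the hypothesis (5) of Thm. 2). The private helpers are copies (suffix `_cw`) of
the private helpers of `LocalizedHybridDirectionStretching.lean` (that file is at the size cap).

## References

* Z. Grujić, R. Guberović, Comm. Math. Phys. 298 (2010) 407–418, (5)–(7) (p. 410), Thm. 2 (p. 415)
  and its proof (13)–(14), pp. 415–417. [GrujicGuberovic2010]
* Z. Grujić, Qi S. Zhang, Comm. Math. Phys. 262 (2006) 555–564, Thm. 1.1 and its proof §3
  (3.2)–(3.10) (pp. 561–563). [GrujicZhang2006]
* D. Chae, Rev. Mat. Iberoam. 23 (2007) 371–384, Thm. 1.2 (the scaling line). [Chae2007RMI]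
* H. Beirão da Veiga, L. C. Berselli, Differential Integral Equations 15 (2002) 345–356, Lemma 4.1
  (4.6)–(4.12). [BeiraodaveigaBerselli2002]
* E. M. Stein, *Singular Integrals…* (1970), Ch. V §1.2 Thm. 1 (Hardy–Littlewood–Sobolev). [Stein1971]
-/

noncomputable section

open MeasureTheory Set Function Filter Metric Real InnerProductSpace
open _root_.Topology
open scoped ENNReal NNReal RealInnerProductSpace

namespace Literature.Analysis.FluidPDE

-- nested operator types `ℝ³ →L[ℝ] ℝ³ →L[ℝ] ℝ³` (second derivatives)
set_option maxSynthPendingDepth 3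

/-! ### Private helpers (copies of the private helpers of `LocalizedHybridDirectionStretching`) -/

/-- A function whose topological support lies in a closed ball has compact support. [folklore] -/
private theorem hasCompactSupport_of_tsupport_subset_closedBall_cw {φ : (EuclideanSpace ℝ (Fin 3)) → ℝ}
    {c : (EuclideanSpace ℝ (Fin 3))} {s : ℝ} (h : tsupport φ ⊆ closedBall c s) : HasCompactSupport φ :=
  IsCompact.of_isClosed_subset (isCompact_closedBall c s) (isClosed_tsupport φ) h

/-- `φ² g` is integrable for continuous `φ, g` with `φ` compactly supported. [folklore] -/
private theorem integrable_sq_mul_of_hasCompactSupport_cw {φ : (EuclideanSpace ℝ (Fin 3)) → ℝ}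
    (hφ : Continuous φ) (hφc : HasCompactSupport φ) {g : (EuclideanSpace ℝ (Fin 3)) → ℝ}
    (hg : Continuous g) : Integrable fun x => φ x ^ 2 * g x := by
  have hc : HasCompactSupport (fun x => φ x ^ 2 * g x) := by
    refine hφc.mono fun x hx => ?_
    rw [mem_support] at hx ⊢
    intro h
    exact hx (by rw [h]; ring)
  exact ((hφ.pow 2).mul hg).integrable_of_hasCompactSupport hc

/-- `∫ φ² g ≤ ∫_{B̄(c,r)} g` for `0 ≤ φ ≤ 1` supported in `B̄(c,r)` and `g ≥ 0`. [folklore] -/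
private theorem integral_sq_mul_le_setIntegral_cw {φ : (EuclideanSpace ℝ (Fin 3)) → ℝ}
    (hφ : Continuous φ) (hφ01 : ∀ x, 0 ≤ φ x ∧ φ x ≤ 1) {c : (EuclideanSpace ℝ (Fin 3))} {r : ℝ}
    (hφs : tsupport φ ⊆ closedBall c r) {g : (EuclideanSpace ℝ (Fin 3)) → ℝ} (hg : Continuous g)
    (hg0 : ∀ x, 0 ≤ g x) :
    ∫ x, φ x ^ 2 * g x ≤ ∫ x in closedBall c r, g x := by
  have hφc : HasCompactSupport φ := hasCompactSupport_of_tsupport_subset_closedBall_cw hφs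
  have hgi : IntegrableOn g (closedBall c r) := hg.continuousOn.integrableOn_compact (isCompact_closedBall c r)
  have hzero : ∀ x, x ∉ closedBall c r → φ x ^ 2 * g x = 0 := by
    intro x hx
    have : φ x = 0 := image_eq_zero_of_notMem_tsupport fun h => hx (hφs h)
    rw [this]; ring
  rw [← setIntegral_eq_integral_of_forall_compl_eq_zero (s := closedBall c r) (fun x hx => hzero x hx)]
  refine setIntegral_mono_on ((integrable_sq_mul_of_hasCompactSupport_cw hφ hφc hg).integrableOn) hgi
    measurableSet_closedBall fun x _ => ?_
  have h1 : φ x ^ 2 ≤ 1 := by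
    have := (hφ01 x).1; have := (hφ01 x).2; nlinarith
  calc φ x ^ 2 * g x ≤ 1 * g x := mul_le_mul_of_nonneg_right h1 (hg0 x)
    _ = g x := one_mul _

/-- The gradient of the weighted field `φw`: `∫‖∇(φw)‖² ≤ 2∫φ²‖∇w‖² + 2B_φ² ∫_{B̄(c,r)}|w|²`
(Leibniz rule, `(a+b)² ≤ 2a² + 2b²`, `∇φ = 0` off `B̄(c,s)`). [folklore] -/
private theorem integral_norm_fderiv_smul_sq_le_cw {φ : (EuclideanSpace ℝ (Fin 3)) → ℝ} (hφ : ContDiff ℝ 1 φ)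
    (hφ01 : ∀ x, 0 ≤ φ x ∧ φ x ≤ 1) {c : (EuclideanSpace ℝ (Fin 3))} {s r : ℝ}
    (hφs : tsupport φ ⊆ closedBall c s) (hsr : s ≤ r) {Bφ : ℝ} (hBφ : ∀ x, ‖fderiv ℝ φ x‖ ≤ Bφ)
    {w : (EuclideanSpace ℝ (Fin 3)) → (EuclideanSpace ℝ (Fin 3))} (hw : ContDiff ℝ 1 w) :
    Integrable (fun x => ‖fderiv ℝ (fun x => φ x • w x) x‖ ^ 2) ∧
    ∫ x, ‖fderiv ℝ (fun x => φ x • w x) x‖ ^ 2 ≤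
      2 * (∫ x, φ x ^ 2 * ‖fderiv ℝ w x‖ ^ 2) + 2 * Bφ ^ 2 * ∫ x in closedBall c r, ‖w x‖ ^ 2 := by
  have hφc : HasCompactSupport φ := hasCompactSupport_of_tsupport_subset_closedBall_cw hφs
  have hφcont : Continuous φ := hφ.continuous
  have hwc : Continuous w := hw.continuous
  have hDw : Continuous (fderiv ℝ w) := hw.continuous_fderiv one_ne_zero
  have hW1 : ContDiff ℝ 1 (fun x => φ x • w x) := hφ.smul hw
  have hWc : HasCompactSupport (fun x => φ x • w x) := hφc.smul_right
  have hDWc : Continuous (fderiv ℝ (fun x => φ x • w x)) := hW1.continuous_fderiv one_ne_zero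
  have hsub : closedBall c s ⊆ closedBall c r := closedBall_subset_closedBall hsr
  have hDφ_zero : ∀ x, x ∉ closedBall c s → fderiv ℝ φ x = 0 := fun x hx =>
    fderiv_of_notMem_tsupport ℝ fun h => hx (hφs h)
  have hc2 : HasCompactSupport (fun x => ‖fderiv ℝ (fun x => φ x • w x) x‖ ^ 2) :=
    (hWc.fderiv (𝕜 := ℝ)).norm.mono fun x hx => by
      rw [mem_support] at hx ⊢
      intro h0
      exact hx (by rw [h0]; ring)
  have IDW2 : Integrable fun x => ‖fderiv ℝ (fun x => φ x • w x) x‖ ^ 2 :=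
    (hDWc.norm.pow 2).integrable_of_hasCompactSupport hc2
  have ID' : Integrable fun x => φ x ^ 2 * ‖fderiv ℝ w x‖ ^ 2 :=
    integrable_sq_mul_of_hasCompactSupport_cw hφcont hφc (hDw.norm.pow 2)
  have IYl : IntegrableOn (fun x => ‖w x‖ ^ 2) (closedBall c r) :=
    (hwc.norm.pow 2).continuousOn.integrableOn_compact (isCompact_closedBall _ _)
  have Iind : Integrable fun x => (closedBall c r).indicator (fun x => ‖w x‖ ^ 2) x := by
    rw [integrable_indicator_iff measurableSet_closedBall]; exact IYl
  have hpt : ∀ x, ‖fderiv ℝ (fun x => φ x • w x) x‖ ^ 2 ≤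
      2 * (φ x ^ 2 * ‖fderiv ℝ w x‖ ^ 2) + 2 * Bφ ^ 2 * (closedBall c r).indicator (fun x => ‖w x‖ ^ 2) x := by
    intro x
    have hφd : DifferentiableAt ℝ φ x := (hφ.differentiable one_ne_zero) x
    have hwd : DifferentiableAt ℝ w x := (hw.differentiable one_ne_zero) x
    have hDW : fderiv ℝ (fun x => φ x • w x) x = φ x • fderiv ℝ w x + (fderiv ℝ φ x).smulRight (w x) :=
      fderiv_fun_smul hφd hwd
    have hle : ‖fderiv ℝ (fun x => φ x • w x) x‖ ≤ φ x * ‖fderiv ℝ w x‖ + ‖fderiv ℝ φ x‖ * ‖w x‖ := by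
      rw [hDW]
      refine (norm_add_le _ _).trans (le_of_eq ?_)
      rw [norm_smul, Real.norm_eq_abs, abs_of_nonneg (hφ01 x).1, ContinuousLinearMap.norm_smulRight_apply]
    have hsq : ‖fderiv ℝ (fun x => φ x • w x) x‖ ^ 2 ≤ (φ x * ‖fderiv ℝ w x‖ + ‖fderiv ℝ φ x‖ * ‖w x‖) ^ 2 :=
      pow_le_pow_left₀ (norm_nonneg _) hle 2
    by_cases hxB : x ∈ closedBall c s
    · rw [indicator_of_mem (hsub hxB)]
      have h_b : ‖fderiv ℝ φ x‖ * ‖w x‖ ≤ Bφ * ‖w x‖ := mul_le_mul_of_nonneg_right (hBφ x) (norm_nonneg _)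
      have h0 : 0 ≤ ‖fderiv ℝ φ x‖ * ‖w x‖ := by positivity
      nlinarith only [hsq, h_b, h0, sq_nonneg (φ x * ‖fderiv ℝ w x‖ - ‖fderiv ℝ φ x‖ * ‖w x‖)]
    · rw [hDφ_zero x hxB, norm_zero, zero_mul, add_zero] at hsq
      have hind : 0 ≤ 2 * Bφ ^ 2 * (closedBall c r).indicator (fun x => ‖w x‖ ^ 2) x :=
        mul_nonneg (by positivity) (indicator_nonneg (fun y _ => by positivity) _)
      nlinarith only [hsq, hind, sq_nonneg (φ x * ‖fderiv ℝ w x‖)]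
  refine ⟨IDW2, ?_⟩
  calc ∫ x, ‖fderiv ℝ (fun x => φ x • w x) x‖ ^ 2
      ≤ ∫ x, (2 * (φ x ^ 2 * ‖fderiv ℝ w x‖ ^ 2) +
          2 * Bφ ^ 2 * (closedBall c r).indicator (fun x => ‖w x‖ ^ 2) x) :=
        integral_mono IDW2 ((ID'.const_mul _).add (Iind.const_mul _)) hpt
    _ = 2 * (∫ x, φ x ^ 2 * ‖fderiv ℝ w x‖ ^ 2) + 2 * Bφ ^ 2 * ∫ x in closedBall c r, ‖w x‖ ^ 2 := by
        rw [integral_add (ID'.const_mul _) (Iind.const_mul _), integral_const_mul, integral_const_mul,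
          integral_indicator measurableSet_closedBall]

/-- **The `U`-term by integration by parts, localized** (Grujić 2009 p. 867, the absorption of the
lower-order terms; Lemarié-Rieusset 2016, proof of Thm. 11.7, the `α`-terms): for `Z = φh` with
`|h| ≤ |w|`, `‖∇h‖ ≤ c_θ‖∇w‖`, and a `C¹` field `Ũ` with `‖Ũ‖ ≤ S`,
`∫⟪Z, ∇Ũ Z⟫ ≤ 12 c_θ S ‖φw‖₂ ‖φ∇w‖₂ + 6B_φ(S²‖φw‖₂² + ∫_{B̄(c,r)}|w|²)`
(`abs_integral_inner_fderiv_apply_le_of_hasCompactSupport`, Cauchy–Schwarz, AM–GM). [folklore] -/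
private theorem integral_inner_smul_fderiv_smul_le_cw {φ : (EuclideanSpace ℝ (Fin 3)) → ℝ} (hφ : ContDiff ℝ 1 φ)
    (hφ01 : ∀ x, 0 ≤ φ x ∧ φ x ≤ 1) {c : (EuclideanSpace ℝ (Fin 3))} {s r : ℝ}
    (hφs : tsupport φ ⊆ closedBall c s) (hsr : s ≤ r) {Bφ : ℝ} (hBφ0 : 0 ≤ Bφ) (hBφ : ∀ x, ‖fderiv ℝ φ x‖ ≤ Bφ)
    {w h : (EuclideanSpace ℝ (Fin 3)) → (EuclideanSpace ℝ (Fin 3))} (hw : ContDiff ℝ 1 w) (hh : ContDiff ℝ 1 h)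
    (hh_le : ∀ x, ‖h x‖ ≤ ‖w x‖) {cθ : ℝ} (hcθ : 0 ≤ cθ) (hDh : ∀ x, ‖fderiv ℝ h x‖ ≤ cθ * ‖fderiv ℝ w x‖)
    {Ut : (EuclideanSpace ℝ (Fin 3)) → (EuclideanSpace ℝ (Fin 3))} (hUt : ContDiff ℝ 1 Ut) {S : ℝ} (hS0 : 0 ≤ S)
    (hUtS : ∀ x, ‖Ut x‖ ≤ S) :
    ∫ x, ⟪φ x • h x, fderiv ℝ Ut x (φ x • h x)⟫ ≤
      12 * cθ * S * Real.sqrt (∫ x, φ x ^ 2 * ‖w x‖ ^ 2) * Real.sqrt (∫ x, φ x ^ 2 * ‖fderiv ℝ w x‖ ^ 2) +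
        6 * Bφ * (S ^ 2 * (∫ x, φ x ^ 2 * ‖w x‖ ^ 2) + ∫ x in closedBall c r, ‖w x‖ ^ 2) := by
  have hφc : HasCompactSupport φ := hasCompactSupport_of_tsupport_subset_closedBall_cw hφs
  have hφcont : Continuous φ := hφ.continuous
  have hwc : Continuous w := hw.continuous
  have hDw : Continuous (fderiv ℝ w) := hw.continuous_fderiv one_ne_zero
  have hhc : Continuous h := hh.continuous
  have hsub : closedBall c s ⊆ closedBall c r := closedBall_subset_closedBall hsr
  have hDφ_zero : ∀ x, x ∉ closedBall c s → fderiv ℝ φ x = 0 := fun x hx =>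
    fderiv_of_notMem_tsupport ℝ fun h => hx (hφs h)
  set Z : (EuclideanSpace ℝ (Fin 3)) → (EuclideanSpace ℝ (Fin 3)) := fun x => φ x • h x with hZ
  have hZ1 : ContDiff ℝ 1 Z := hφ.smul hh
  have hZc : HasCompactSupport Z := hφc.smul_right
  have hZcont : Continuous Z := hZ1.continuous
  set Yφ : ℝ := ∫ x, φ x ^ 2 * ‖w x‖ ^ 2 with hYφ
  set D' : ℝ := ∫ x, φ x ^ 2 * ‖fderiv ℝ w x‖ ^ 2 with hD'
  set Yl : ℝ := ∫ x in closedBall c r, ‖w x‖ ^ 2 with hYl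
  have IYφ : Integrable fun x => φ x ^ 2 * ‖w x‖ ^ 2 :=
    integrable_sq_mul_of_hasCompactSupport_cw hφcont hφc (hwc.norm.pow 2)
  have ID' : Integrable fun x => φ x ^ 2 * ‖fderiv ℝ w x‖ ^ 2 :=
    integrable_sq_mul_of_hasCompactSupport_cw hφcont hφc (hDw.norm.pow 2)
  have IYl : IntegrableOn (fun x => ‖w x‖ ^ 2) (closedBall c r) :=
    (hwc.norm.pow 2).continuousOn.integrableOn_compact (isCompact_closedBall _ _)
  have hYφ0 : 0 ≤ Yφ := integral_nonneg fun x => by positivity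
  set sY := Real.sqrt Yφ with hsY
  have h1 : |∫ x, ⟪Z x, fderiv ℝ Ut x (Z x)⟫| ≤ 12 * S * ∫ x, ‖Z x‖ * ‖fderiv ℝ Z x‖ :=
    abs_integral_inner_fderiv_apply_le_of_hasCompactSupport hZ1 hZc hUt hUtS
  -- pointwise: `‖Z‖‖DZ‖ ≤ cθ φ²|w|‖Dw‖ + Bφ 1_{B̄(c,s)} φ |w|²`
  have hZD : ∀ x, ‖Z x‖ * ‖fderiv ℝ Z x‖ ≤
      cθ * (φ x ^ 2 * (‖w x‖ * ‖fderiv ℝ w x‖)) +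
        Bφ * (closedBall c s).indicator (fun x => φ x * ‖w x‖ ^ 2) x := by
    intro x
    have hφd : DifferentiableAt ℝ φ x := (hφ.differentiable one_ne_zero) x
    have hhd : DifferentiableAt ℝ h x := (hh.differentiable one_ne_zero) x
    have hDZ : fderiv ℝ Z x = φ x • fderiv ℝ h x + (fderiv ℝ φ x).smulRight (h x) :=
      fderiv_fun_smul hφd hhd
    have hZx : ‖Z x‖ = φ x * ‖h x‖ := by
      show ‖φ x • h x‖ = _; rw [norm_smul, Real.norm_eq_abs, abs_of_nonneg (hφ01 x).1]
    have hDZle : ‖fderiv ℝ Z x‖ ≤ φ x * (cθ * ‖fderiv ℝ w x‖) + ‖fderiv ℝ φ x‖ * ‖h x‖ := by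
      rw [hDZ]
      calc ‖φ x • fderiv ℝ h x + (fderiv ℝ φ x).smulRight (h x)‖
          ≤ ‖φ x • fderiv ℝ h x‖ + ‖(fderiv ℝ φ x).smulRight (h x)‖ := norm_add_le _ _
        _ = φ x * ‖fderiv ℝ h x‖ + ‖fderiv ℝ φ x‖ * ‖h x‖ := by
            rw [norm_smul, Real.norm_eq_abs, abs_of_nonneg (hφ01 x).1,
              ContinuousLinearMap.norm_smulRight_apply]
        _ ≤ φ x * (cθ * ‖fderiv ℝ w x‖) + ‖fderiv ℝ φ x‖ * ‖h x‖ := by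
            have := mul_le_mul_of_nonneg_left (hDh x) (hφ01 x).1
            linarith
    have hφ0 := (hφ01 x).1
    have hZnn : 0 ≤ φ x * ‖h x‖ := mul_nonneg hφ0 (norm_nonneg _)
    have hprod : ‖Z x‖ * ‖fderiv ℝ Z x‖ ≤
        (φ x * ‖h x‖) * (φ x * (cθ * ‖fderiv ℝ w x‖) + ‖fderiv ℝ φ x‖ * ‖h x‖) := by
      rw [hZx]; exact mul_le_mul_of_nonneg_left hDZle hZnn
    have hA : (φ x * ‖h x‖) * (φ x * (cθ * ‖fderiv ℝ w x‖)) ≤ cθ * (φ x ^ 2 * (‖w x‖ * ‖fderiv ℝ w x‖)) := by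
      have := hh_le x
      have h2 : 0 ≤ φ x * (cθ * ‖fderiv ℝ w x‖) := by positivity
      calc (φ x * ‖h x‖) * (φ x * (cθ * ‖fderiv ℝ w x‖))
          ≤ (φ x * ‖w x‖) * (φ x * (cθ * ‖fderiv ℝ w x‖)) :=
            mul_le_mul_of_nonneg_right (mul_le_mul_of_nonneg_left this hφ0) h2
        _ = cθ * (φ x ^ 2 * (‖w x‖ * ‖fderiv ℝ w x‖)) := by ring
    by_cases hxB : x ∈ closedBall c s
    · rw [indicator_of_mem hxB]
      have hB : (φ x * ‖h x‖) * (‖fderiv ℝ φ x‖ * ‖h x‖) ≤ Bφ * (φ x * ‖w x‖ ^ 2) := by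
        have e1 : φ x * ‖h x‖ ≤ φ x * ‖w x‖ := mul_le_mul_of_nonneg_left (hh_le x) hφ0
        have e2 : ‖fderiv ℝ φ x‖ * ‖h x‖ ≤ Bφ * ‖w x‖ := mul_le_mul (hBφ x) (hh_le x) (norm_nonneg _) hBφ0
        calc (φ x * ‖h x‖) * (‖fderiv ℝ φ x‖ * ‖h x‖) ≤ (φ x * ‖w x‖) * (Bφ * ‖w x‖) :=
              mul_le_mul e1 e2 (by positivity) (by positivity)
          _ = Bφ * (φ x * ‖w x‖ ^ 2) := by ring
      calc ‖Z x‖ * ‖fderiv ℝ Z x‖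
          ≤ (φ x * ‖h x‖) * (φ x * (cθ * ‖fderiv ℝ w x‖) + ‖fderiv ℝ φ x‖ * ‖h x‖) := hprod
        _ = (φ x * ‖h x‖) * (φ x * (cθ * ‖fderiv ℝ w x‖)) + (φ x * ‖h x‖) * (‖fderiv ℝ φ x‖ * ‖h x‖) := by ring
        _ ≤ cθ * (φ x ^ 2 * (‖w x‖ * ‖fderiv ℝ w x‖)) + Bφ * (φ x * ‖w x‖ ^ 2) := add_le_add hA hB
    · rw [indicator_of_notMem hxB, mul_zero, add_zero]
      have hD0 : fderiv ℝ φ x = 0 := hDφ_zero x hxB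
      calc ‖Z x‖ * ‖fderiv ℝ Z x‖
          ≤ (φ x * ‖h x‖) * (φ x * (cθ * ‖fderiv ℝ w x‖) + ‖fderiv ℝ φ x‖ * ‖h x‖) := hprod
        _ = (φ x * ‖h x‖) * (φ x * (cθ * ‖fderiv ℝ w x‖)) := by rw [hD0, norm_zero, zero_mul, add_zero]
        _ ≤ cθ * (φ x ^ 2 * (‖w x‖ * ‖fderiv ℝ w x‖)) := hA
  -- `∫ φ²|w|‖Dw‖ ≤ √Yφ √D'`
  have e2 : (fun x => ‖φ x • w x‖ ^ 2) = fun x => φ x ^ 2 * ‖w x‖ ^ 2 := by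
    funext x; rw [norm_smul, Real.norm_eq_abs, abs_of_nonneg (hφ01 x).1]; ring
  have e3 : (fun x => ‖φ x • fderiv ℝ w x‖ ^ 2) = fun x => φ x ^ 2 * ‖fderiv ℝ w x‖ ^ 2 := by
    funext x; rw [norm_smul, Real.norm_eq_abs, abs_of_nonneg (hφ01 x).1]; ring
  have hcs1 : ∫ x, φ x ^ 2 * (‖w x‖ * ‖fderiv ℝ w x‖) ≤ sY * Real.sqrt D' := by
    have h := integral_norm_mul_norm_le_sqrt (f := fun x => φ x • w x)
      (g := fun x => φ x • fderiv ℝ w x) (hφcont.smul hwc) (hφcont.smul hDw)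
      (by rw [e2]; exact IYφ) (by rw [e3]; exact ID')
    have e1 : (fun x => ‖φ x • w x‖ * ‖φ x • fderiv ℝ w x‖) =
        fun x => φ x ^ 2 * (‖w x‖ * ‖fderiv ℝ w x‖) := by
      funext x
      rw [norm_smul, norm_smul, Real.norm_eq_abs, abs_of_nonneg (hφ01 x).1]; ring
    rw [e1, e2, e3] at h
    exact h
  -- the indicator term: `2 S ∫ 1_{B̄} φ|w|² ≤ S² Yφ + Yl`
  have Iind : Integrable fun x => (closedBall c s).indicator (fun x => φ x * ‖w x‖ ^ 2) x := by
    rw [integrable_indicator_iff measurableSet_closedBall]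
    exact ((hφcont.mul (hwc.norm.pow 2)).continuousOn.integrableOn_compact (isCompact_closedBall _ _))
  have Iind6 : Integrable fun x => (closedBall c r).indicator (fun x => ‖w x‖ ^ 2) x := by
    rw [integrable_indicator_iff measurableSet_closedBall]; exact IYl
  have hind_le : 2 * S * ∫ x, (closedBall c s).indicator (fun x => φ x * ‖w x‖ ^ 2) x ≤ S ^ 2 * Yφ + Yl := by
    have hpt : ∀ x, 2 * S * (closedBall c s).indicator (fun x => φ x * ‖w x‖ ^ 2) x ≤
        S ^ 2 * (φ x ^ 2 * ‖w x‖ ^ 2) + (closedBall c r).indicator (fun x => ‖w x‖ ^ 2) x := by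
      intro x
      by_cases hxB : x ∈ closedBall c s
      · rw [indicator_of_mem hxB, indicator_of_mem (hsub hxB)]
        nlinarith only [sq_nonneg (S * φ x * ‖w x‖ - ‖w x‖), sq_nonneg (‖w x‖), (hφ01 x).1, hS0]
      · rw [indicator_of_notMem hxB, mul_zero]
        have : 0 ≤ (closedBall c r).indicator (fun x => ‖w x‖ ^ 2) x :=
          indicator_nonneg (fun y _ => by positivity) _
        positivity
    calc 2 * S * ∫ x, (closedBall c s).indicator (fun x => φ x * ‖w x‖ ^ 2) x
        = ∫ x, 2 * S * (closedBall c s).indicator (fun x => φ x * ‖w x‖ ^ 2) x := by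
          rw [integral_const_mul]
      _ ≤ ∫ x, (S ^ 2 * (φ x ^ 2 * ‖w x‖ ^ 2) + (closedBall c r).indicator (fun x => ‖w x‖ ^ 2) x) :=
          integral_mono (Iind.const_mul _) ((IYφ.const_mul _).add Iind6) hpt
      _ = S ^ 2 * Yφ + Yl := by
          rw [integral_add (IYφ.const_mul _) Iind6, integral_const_mul,
            integral_indicator measurableSet_closedBall]
  have IZD : Integrable fun x => ‖Z x‖ * ‖fderiv ℝ Z x‖ :=
    (hZcont.norm.mul (hZ1.continuous_fderiv one_ne_zero).norm).integrable_of_hasCompactSupport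
      (hZc.norm.mul_right)
  have IwDw : Integrable fun x => φ x ^ 2 * (‖w x‖ * ‖fderiv ℝ w x‖) :=
    integrable_sq_mul_of_hasCompactSupport_cw hφcont hφc (hwc.norm.mul hDw.norm)
  have h2 : ∫ x, ‖Z x‖ * ‖fderiv ℝ Z x‖ ≤
      cθ * (sY * Real.sqrt D') + Bφ * ∫ x, (closedBall c s).indicator (fun x => φ x * ‖w x‖ ^ 2) x := by
    calc ∫ x, ‖Z x‖ * ‖fderiv ℝ Z x‖
        ≤ ∫ x, (cθ * (φ x ^ 2 * (‖w x‖ * ‖fderiv ℝ w x‖)) +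
            Bφ * (closedBall c s).indicator (fun x => φ x * ‖w x‖ ^ 2) x) :=
          integral_mono IZD ((IwDw.const_mul _).add (Iind.const_mul _)) hZD
      _ = cθ * (∫ x, φ x ^ 2 * (‖w x‖ * ‖fderiv ℝ w x‖)) +
            Bφ * ∫ x, (closedBall c s).indicator (fun x => φ x * ‖w x‖ ^ 2) x := by
          rw [integral_add (IwDw.const_mul _) (Iind.const_mul _), integral_const_mul, integral_const_mul]
      _ ≤ cθ * (sY * Real.sqrt D') +
            Bφ * ∫ x, (closedBall c s).indicator (fun x => φ x * ‖w x‖ ^ 2) x := by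
          have := mul_le_mul_of_nonneg_left hcs1 hcθ
          linarith
  have hind0 : 0 ≤ ∫ x, (closedBall c s).indicator (fun x => φ x * ‖w x‖ ^ 2) x :=
    integral_nonneg fun x => indicator_nonneg (fun y _ => mul_nonneg (hφ01 y).1 (sq_nonneg _)) _
  have hS12 : 0 ≤ 12 * S := by positivity
  calc ∫ x, ⟪Z x, fderiv ℝ Ut x (Z x)⟫ ≤ |∫ x, ⟪Z x, fderiv ℝ Ut x (Z x)⟫| := le_abs_self _
    _ ≤ 12 * S * ∫ x, ‖Z x‖ * ‖fderiv ℝ Z x‖ := h1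
    _ ≤ 12 * S * (cθ * (sY * Real.sqrt D') +
          Bφ * ∫ x, (closedBall c s).indicator (fun x => φ x * ‖w x‖ ^ 2) x) :=
        mul_le_mul_of_nonneg_left h2 hS12
    _ = 12 * cθ * S * sY * Real.sqrt D' +
          6 * Bφ * (2 * S * ∫ x, (closedBall c s).indicator (fun x => φ x * ‖w x‖ ^ 2) x) := by ring
    _ ≤ 12 * cθ * S * sY * Real.sqrt D' + 6 * Bφ * (S ^ 2 * Yφ + Yl) := by
        have e := mul_le_mul_of_nonneg_left hind_le (by positivity : (0:ℝ) ≤ 6 * Bφ)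
        linarith


/-- Cauchy–Schwarz on a closed ball: `∫_B h ≤ √(vol B) √(∫_B h²)` for a continuous `h ≥ 0`. [folklore] -/
private theorem setIntegral_closedBall_le_sqrt_vol_mul_sqrt_cw {h : (EuclideanSpace ℝ (Fin 3)) → ℝ} (hh : Continuous h)
    (h0 : ∀ x, 0 ≤ h x) (c : (EuclideanSpace ℝ (Fin 3))) (r : ℝ) :
    ∫ x in closedBall c r, h x ≤
      Real.sqrt ((volume : Measure (EuclideanSpace ℝ (Fin 3))).real (closedBall c r)) *
        Real.sqrt (∫ x in closedBall c r, h x ^ 2) := by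
  set μ : Measure (EuclideanSpace ℝ (Fin 3)) :=
    (volume : Measure (EuclideanSpace ℝ (Fin 3))).restrict (closedBall c r) with hμ
  haveI : IsFiniteMeasure μ := isFiniteMeasure_restrict.2 (measure_closedBall_lt_top).ne
  obtain ⟨M, hM⟩ := (isCompact_closedBall c r).exists_bound_of_continuousOn hh.continuousOn
  have hmem1 : MemLp (fun _ : (EuclideanSpace ℝ (Fin 3)) => (1 : ℝ)) (ENNReal.ofReal 2) μ := memLp_const 1
  have hbd : ∀ᵐ x ∂μ, h x ∈ Icc (-M) M := by
    refine ae_restrict_of_forall_mem measurableSet_closedBall fun x hx => ?_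
    have hx' := hM x hx
    rw [Real.norm_eq_abs] at hx'
    exact ⟨by linarith [neg_abs_le (h x)], (le_abs_self _).trans hx'⟩
  have hmemh : MemLp h (ENNReal.ofReal 2) μ := memLp_of_bounded hbd hh.aestronglyMeasurable _
  have hcs := integral_mul_le_Lp_mul_Lq_of_nonneg (μ := μ) Real.HolderConjugate.two_two
    (f := fun _ => (1 : ℝ)) (g := h) (ae_of_all _ fun _ => zero_le_one) (ae_of_all _ h0) hmem1 hmemh
  have e1 : ∫ _a, (1 : ℝ) ^ (2 : ℝ) ∂μ = (volume : Measure (EuclideanSpace ℝ (Fin 3))).real (closedBall c r) := by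
    simp only [Real.one_rpow, integral_const, smul_eq_mul, mul_one]
    rw [hμ, measureReal_restrict_apply_univ]
  have e2 : ∫ a, h a ^ (2 : ℝ) ∂μ = ∫ x in closedBall c r, h x ^ 2 := by
    rw [hμ]
    refine integral_congr_ae (Eventually.of_forall fun x => ?_)
    simp only [Real.rpow_two]
  have e3 : ∫ a, (1 : ℝ) * h a ∂μ = ∫ x in closedBall c r, h x := by
    rw [hμ]
    refine integral_congr_ae (Eventually.of_forall fun x => ?_)
    simp only [one_mul]
  rw [e1, e2, e3] at hcs
  rw [Real.sqrt_eq_rpow, Real.sqrt_eq_rpow]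
  exact hcs


/-- The potential `∫ |x−y|^{α−3} |h(y)| dy` (`α > 0`) of a continuous compactly supported `h`
converges absolutely. [folklore] -/
private theorem integrable_rieszKernel_mul_norm_cw {α : ℝ} (hα : 0 < α)
    {h : (EuclideanSpace ℝ (Fin 3)) → (EuclideanSpace ℝ (Fin 3))} (hh : Continuous h)
    (hhc : HasCompactSupport h) (x : (EuclideanSpace ℝ (Fin 3))) :
    Integrable fun y => ‖x - y‖ ^ (α - 3) * ‖h y‖ := by
  obtain ⟨M₀, hM₀⟩ := hh.bounded_above_of_compact_support hhc
  have hM₀0 : 0 ≤ M₀ := (norm_nonneg _).trans (hM₀ x)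
  obtain ⟨R₀, hR₀⟩ := hhc.isCompact.isBounded.subset_closedBall (0 : (EuclideanSpace ℝ (Fin 3)))
  set ρ' : ℝ := |R₀| + ‖x‖ + 1 with hρ'
  have hexp : α - 3 = -(3 - α) := by ring
  have hball : Integrable fun z : (EuclideanSpace ℝ (Fin 3)) =>
      (ball (0 : (EuclideanSpace ℝ (Fin 3))) ρ').indicator (fun z => ‖z‖ ^ (α - 3)) z := by
    rw [integrable_indicator_iff measurableSet_ball, hexp]
    exact NewtonPotentialHolder.integrableOn_ball_norm_rpow_neg (by linarith) ρ'
  have hmaj : Integrable fun y => M₀ *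
      (ball (0 : (EuclideanSpace ℝ (Fin 3))) ρ').indicator (fun z => ‖z‖ ^ (α - 3)) (x - y) :=
    (hball.comp_sub_left x).const_mul _
  have hmeas : AEStronglyMeasurable (fun y => ‖x - y‖ ^ (α - 3) * ‖h y‖) volume :=
    (((measurable_const.sub measurable_id).norm.pow_const _).mul
      hh.measurable.norm).aestronglyMeasurable
  refine hmaj.mono' hmeas (Eventually.of_forall fun y => ?_)
  have hk0 : 0 ≤ ‖x - y‖ ^ (α - 3) := Real.rpow_nonneg (norm_nonneg _) _
  rw [Real.norm_of_nonneg (mul_nonneg hk0 (norm_nonneg _))]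
  by_cases hy : h y = 0
  · rw [hy, norm_zero, mul_zero]
    exact mul_nonneg hM₀0 (indicator_nonneg (fun z _ => Real.rpow_nonneg (norm_nonneg _) _) _)
  · have hyR : ‖y‖ ≤ R₀ := mem_closedBall_zero_iff.1 (hR₀ (subset_tsupport _ (mem_support.2 hy)))
    have hxy : ‖x - y‖ < ρ' := by
      calc ‖x - y‖ ≤ ‖x‖ + ‖y‖ := norm_sub_le _ _
        _ < |R₀| + ‖x‖ + 1 := by linarith [le_abs_self R₀]
    have hmem : x - y ∈ ball (0 : (EuclideanSpace ℝ (Fin 3))) ρ' := mem_ball_zero_iff.2 hxy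
    rw [indicator_of_mem hmem]
    calc ‖x - y‖ ^ (α - 3) * ‖h y‖ ≤ ‖x - y‖ ^ (α - 3) * M₀ :=
          mul_le_mul_of_nonneg_left (hM₀ y) hk0
      _ = M₀ * ‖x - y‖ ^ (α - 3) := mul_comm _ _


/-- The interpolation exponent `β = 3/(2p) − 1/2 = (3−p)/(2p)` of the printed proof (there
`1 < p ≤ 3/2`, `1/2 ≤ β < 1`; here any `1 < p < 3`, `0 < β < 1`), the Hölder pair
`(2/(3−p), 2/(p−1))` used for
`∫|ω|^{2p} ≤ (∫|ω|²)^{(3−p)/2}(∫|ω|⁶)^{(p−1)/2}`, and the identities linking `β` with the Young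
exponents `2p/(3−p)`, `p/(3−p)`. [cite: BeiraodaveigaBerselli2002, p. 353] -/
private theorem hybrid_beta_cw {p : ℝ} (h1p : 1 < p) (hp : p < 3) :
    0 < (3 - p) / (2 * p) ∧ (3 - p) / (2 * p) < 1 ∧
      (2 / (3 - p)).HolderConjugate (2 / (p - 1)) ∧
      2 / (2 / (3 - p)) + 6 / (2 / (p - 1)) = ((2 : ℕ) : ℝ) * p ∧
      1 / (2 / (3 - p)) * (1 / p) = (3 - p) / (2 * p) ∧
      ((6 : ℕ) : ℝ) * (1 / (2 / (p - 1)) * (1 / p)) = 2 - 2 * ((3 - p) / (2 * p)) ∧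
      1 / ((3 - p) / (2 * p)) = 2 * p / (3 - p) ∧
      ((3 - p) / (2 * p) + 1 / 2) * (2 * p / (3 - p)) = p / (3 - p) + 1 ∧
      (1 / (2 : ℝ)) * (2 - 2 * ((3 - p) / (2 * p))) = 1 - (3 - p) / (2 * p) := by
  have h1 : 0 < 3 - p := by linarith
  have h2 : 0 < p - 1 := by linarith
  have hp0 : 0 < p := by linarith
  refine ⟨by positivity, ?_, ?_, ?_, ?_, ?_, ?_, ?_, ?_⟩
  · rw [div_lt_one (by positivity)]; linarith
  · refine Real.holderConjugate_iff.2 ⟨?_, ?_⟩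
    · rw [lt_div_iff₀ h1]; linarith
    · field_simp; ring
  · push_cast; field_simp; ring
  · field_simp
  · push_cast; field_simp; ring
  · rw [one_div_div]
  · field_simp; ring
  · ring

/-- Lebesgue interpolation between `L²` and `L⁶` for the Hölder pair `(r₁, r₂)`:
`∫ |f|^{2/r₁ + 6/r₂} ≤ (∫ |f|²)^{1/r₁} (∫ |f|⁶)^{1/r₂}` (Hölder on `|f|^{2/r₁} · |f|^{6/r₂}`) — "the
classical interpolation results in `L^p`-spaces (note that `2 ≤ 2p < 6)`" of the printed proof.
[folklore] -/
private theorem lintegral_enorm_rpow_le_interp_cw {X F : Type*} [MeasurableSpace X]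
    [NormedAddCommGroup F] (μ : Measure X) {f : X → F} (hf : AEStronglyMeasurable f μ)
    {r₁ r₂ : ℝ} (hr : r₁.HolderConjugate r₂) :
    ∫⁻ x, ‖f x‖ₑ ^ (2 / r₁ + 6 / r₂) ∂μ ≤
      (∫⁻ x, ‖f x‖ₑ ^ (2 : ℝ) ∂μ) ^ (1 / r₁) * (∫⁻ x, ‖f x‖ₑ ^ (6 : ℝ) ∂μ) ^ (1 / r₂) := by
  have hr1 : 0 < r₁ := hr.pos
  have hr2 : 0 < r₂ := hr.symm.pos
  have hm : AEMeasurable (fun x => ‖f x‖ₑ ^ (2 / r₁)) μ := hf.enorm.pow_const _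
  have hm' : AEMeasurable (fun x => ‖f x‖ₑ ^ (6 / r₂)) μ := hf.enorm.pow_const _
  have h := ENNReal.lintegral_mul_le_Lp_mul_Lq μ hr hm hm'
  have e1 : ∀ x, ((fun x => ‖f x‖ₑ ^ (2 / r₁)) * fun x => ‖f x‖ₑ ^ (6 / r₂)) x =
      ‖f x‖ₑ ^ (2 / r₁ + 6 / r₂) := fun x => by
    rw [Pi.mul_apply, ← ENNReal.rpow_add_of_nonneg _ _ (by positivity) (by positivity)]
  have e2 : ∀ x, (‖f x‖ₑ ^ (2 / r₁)) ^ r₁ = ‖f x‖ₑ ^ (2 : ℝ) := fun x => by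
    rw [← ENNReal.rpow_mul, div_mul_cancel₀ _ hr1.ne']
  have e3 : ∀ x, (‖f x‖ₑ ^ (6 / r₂)) ^ r₂ = ‖f x‖ₑ ^ (6 : ℝ) := fun x => by
    rw [← ENNReal.rpow_mul, div_mul_cancel₀ _ hr2.ne']
  simp_rw [e1, e2, e3] at h
  exact h

/-- Young's inequality with exponents `1/(1−β)` and `1/β` (`0 < β < 1`) in the form used for
(4.10): `2 X D^{1−β} ≤ (ν/2) D + c(ν,β) X^{1/β}`, `c(ν,β) = β (2/c₀)^{1/β}`,
`c₀ = (ν/(2(1−β)))^{1−β}`. [folklore] -/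
private theorem two_mul_mul_rpow_le_young_cw {ν β X D : ℝ} (hν : 0 < ν) (hβ0 : 0 < β) (hβ1 : β < 1)
    (hX : 0 ≤ X) (hD : 0 ≤ D) :
    2 * X * D ^ (1 - β) ≤ ν / 2 * D +
      β * (2 / (ν / (2 * (1 - β))) ^ (1 - β)) ^ (1 / β) * X ^ (1 / β) := by
  have h1β : 0 < 1 - β := by linarith
  set c : ℝ := (ν / (2 * (1 - β))) ^ (1 - β) with hc
  have hc0 : 0 < c := Real.rpow_pos_of_pos (by positivity) _
  have hPQ : (1 / (1 - β)).HolderConjugate (1 / β) := by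
    refine Real.holderConjugate_iff.2 ⟨?_, ?_⟩
    · rw [lt_div_iff₀ h1β]; linarith
    · rw [one_div, one_div, inv_inv, inv_inv]; ring
  have hy := Real.young_inequality_of_nonneg (a := c * D ^ (1 - β)) (b := 2 * X / c)
    (by positivity) (by positivity) hPQ
  have hl : c * D ^ (1 - β) * (2 * X / c) = 2 * X * D ^ (1 - β) := by
    field_simp
  have hr1 : (c * D ^ (1 - β)) ^ (1 / (1 - β)) / (1 / (1 - β)) = ν / 2 * D := by
    rw [Real.mul_rpow hc0.le (Real.rpow_nonneg hD _), ← Real.rpow_mul hD,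
      mul_one_div_cancel h1β.ne', Real.rpow_one, hc, ← Real.rpow_mul (by positivity),
      mul_one_div_cancel h1β.ne', Real.rpow_one]
    field_simp
  have hr2 : (2 * X / c) ^ (1 / β) / (1 / β) =
      β * (2 / c) ^ (1 / β) * X ^ (1 / β) := by
    rw [show 2 * X / c = 2 / c * X by ring, Real.mul_rpow (by positivity) hX]
    field_simp
  rw [hl, hr1, hr2] at hy
  exact hy


/-! ### The localized stretching estimate with the coherence of the vorticity direction as a
WEIGHT on the convolution variable (Grujić–Guberović 2010, Thm. 2) -/

set_option maxHeartbeats 3200000 in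
/-- **The localized stretching estimate in Grujić–Guberović's coherence-weighted class**
(Grujić–Guberović 2010, Thm. 2, the estimate of the leading-order vortex-stretching term `J` at a
fixed time, §4 pp. 415–417: "Hölder inequality in `x` with the exponents `α, p₁` and `p₂` applied
to (14) … the Hardy–Littlewood–Sobolev inequality … Interpolating the last two factors …"). Same
frame, exponents and constants `C₁, …, C₄` as
`exists_localized_stretching_le_of_holderExp_of_vorticity_Lr` (Hölder exponent `α > 0`, Lebesgue
exponent `1 < r`, `αr < 3`, `1/r < (2+α)/3`, `θ = 1 + α/2 − (3/2)(1/r)` — in the notation of the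
source `(α, r) = (γ, α)` and `1/(rθ) = 2/((2+γ)α − 3) = δ`, the scaling-invariance exponent (6)),
but the uniform Hölder constant is replaced by a measurable, nonnegative, bounded WEIGHT `m` on the
convolution variable: if `√(1 − ⟪ξ(x), ξ(y)⟫²) ≤ m(y)|x − y|^α` for all `x, y ∈ B(c, 6s)` with
`|ω(x)|, |ω(y)| > Ω`, then
`2∫φ²⟪ω,(∇V)ω⟫ ≤ ν∫φ²|∇ω|²_F + (C₁ + C₂(Y + F) + C₃E + C₅ (∫_{B̄(c,6s)} (m|ω|)^r)^{1/(rθ)})∫φ²|ω|²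
+ C₄(Y + F)`. For the printed `γ`-Hölder measure of coherence
`ρ_{γ,2R}(y,t) = sup_{z ∈ B(y,2R), z ≠ y} |sin φ(ξ(y,t), ξ(z,t))|/|y − z|^γ` one takes `m = ρ_{γ,2R}`
on the high-vorticity points of a ball of radius `< R` (the quotient is symmetric in its two
arguments), and the weight is `‖ρ_{γ,2R} ω‖_{L^α(B)}^{αδ}`, the integrand of the class (5). Proof:
that of `exists_localized_stretching_le_of_holderExp_of_vorticity_Lr` verbatim, with the depletion
`exists_abs_inner_highPart_fderiv_biotSavart_cutoff_le_holderWeight` and the Hardy–Littlewood–Sobolev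
density `m·|χω_hi| ≤ m|ω|` on `B̄(c, 6s)` (recorded deviation from print: pointwise-in-time Young
with exponents `1/(1−θ), 1/θ` instead of the space–time Hölder inequality "with the exponents
`2/(γ+3(1−1/α)−1)`, `∞` and `2/(3−γ−3(1−1/α))`" and absorption for small `r`, p. 417).
[cite: GrujicGuberovic2010, Thm. 2 (p. 415) with proof (13)–(14) and pp. 416–417; GrujicZhang2006, Thm. 1.1 proof §3 (3.7)–(3.9); Stein1971, Ch. V §1.2 Thm. 1] -/
theorem exists_localized_stretching_le_of_holderWeight_Lr (c : (EuclideanSpace ℝ (Fin 3)))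
    {s ν Ω α r θ : ℝ} (hs : 0 < s) (hν : 0 < ν) (hΩ : 0 < Ω) (hα : 0 < α) (hr : 1 < r)
    (hαr : α * r < 3) (hup : 1 / r < (2 + α) / 3) (hθ : θ = 1 + α / 2 - 3 / 2 * (1 / r))
    {φ : (EuclideanSpace ℝ (Fin 3)) → ℝ} (hφ : ContDiff ℝ 1 φ) (hφ01 : ∀ x, 0 ≤ φ x ∧ φ x ≤ 1)
    (hφs : tsupport φ ⊆ closedBall c s) :
    ∃ C₁ C₂ C₃ C₄ C₅ : ℝ, 0 ≤ C₁ ∧ 0 ≤ C₂ ∧ 0 ≤ C₃ ∧ 0 ≤ C₄ ∧ 0 ≤ C₅ ∧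
      ∀ ⦃V : (EuclideanSpace ℝ (Fin 3)) → (EuclideanSpace ℝ (Fin 3))⦄ (_ : ContDiff ℝ 2 V)
        (_ : ∀ y ∈ ball c (6 * s), VectorCalculus.divergence V y = 0)
        ⦃m : (EuclideanSpace ℝ (Fin 3)) → ℝ⦄ ⦃Mb : ℝ⦄ (_ : Measurable m) (_ : ∀ y, 0 ≤ m y)
        (_ : ∀ y, m y ≤ Mb)
        (_ : ∀ x ∈ ball c (6 * s), ∀ y ∈ ball c (6 * s), Ω < ‖curl V x‖ → Ω < ‖curl V y‖ →
          Real.sqrt (1 - ⟪vorticityDirection (curl V) x, vorticityDirection (curl V) y⟫ ^ 2) ≤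
            m y * ‖x - y‖ ^ α),
        2 * ∫ x, φ x ^ 2 * ⟪curl V x, fderiv ℝ V x (curl V x)⟫ ≤
          ν * (∫ x, φ x ^ 2 * frobeniusNormSq (fderiv ℝ (curl V) x)) +
            (C₁ + C₂ * ((∫ x in closedBall c (6 * s), ‖curl V x‖ ^ 2) +
                (∫ x in closedBall c (6 * s), ‖fderiv ℝ V x‖ ^ 2)) +
              C₃ * (∫ x in closedBall c (6 * s), ‖V x‖ ^ 2) +
              C₅ * (∫ x in closedBall c (6 * s), (m x * ‖curl V x‖) ^ r) ^ (1 / (r * θ))) *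
              (∫ x, φ x ^ 2 * ‖curl V x‖ ^ 2) +
            C₄ * ((∫ x in closedBall c (6 * s), ‖curl V x‖ ^ 2) +
              (∫ x in closedBall c (6 * s), ‖fderiv ℝ V x‖ ^ 2)) := by
  -- ### universal constants
  obtain ⟨A, hA0, hdep⟩ := exists_abs_inner_highPart_fderiv_biotSavart_cutoff_le_holderWeight
  obtain ⟨CF, hCF0, hsupF⟩ := exists_norm_sub_biotSavart_ballCutoff_le c hs
  obtain ⟨Bθ, hBθ0, hBθ⟩ := exists_norm_fderiv_radialCutoff_le
  set K₀ : ℝ≥0 := SNormLESNormFDerivOfEqConst (EuclideanSpace ℝ (Fin 3))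
    (volume : Measure (EuclideanSpace ℝ (Fin 3))) 2 with hK₀
  set K : ℝ := (K₀ : ℝ) + 1 with hK
  have hK0 : 0 < K := by rw [hK]; positivity
  set cθ : ℝ := 1 + 2 * Bθ with hcθdef
  have hcθ0 : 0 ≤ cθ := by positivity
  -- ### exponents: `1/q = 1/r − α/3` (HLS), `1/p = 1 − 1/q`, `β = (3−p)/(2p) = θ`
  have hα0 : 0 < α := hα
  have hr0 : 0 < r := by linarith
  have hrinv : 1 / r < 1 := by rw [div_lt_one hr0]; exact hr
  have hαr' : α / 3 < 1 / r := by
    rw [div_lt_div_iff₀ (by norm_num : (0 : ℝ) < 3) hr0]; linarith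
  have h3αr : 0 < 3 - α * r := by linarith
  set d₁ : ℝ := 1 - 1 / r + α / 3 with hd₁
  have hd₁0 : 0 < d₁ := by rw [hd₁]; linarith
  have hd₁1 : d₁ < 1 := by rw [hd₁]; linarith
  have hd₁3 : 1 / 3 < d₁ := by rw [hd₁]; linarith
  set p : ℝ := 1 / d₁ with hpdef
  set q : ℝ := (3 : ℝ) * r / (3 - α * r) with hqdef
  have hp0 : 0 < p := by positivity
  have h1p : 1 < p := by rw [hpdef, lt_div_iff₀ hd₁0]; linarith
  have hp3 : p < 3 := by rw [hpdef, div_lt_iff₀ hd₁0]; linarith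
  have h3p : 0 < 3 - p := by linarith
  have hpinv : 1 / p = d₁ := by rw [hpdef, one_div_one_div]
  have hqinv : 1 / q = 1 / r - α / 3 := by
    rw [hqdef]; field_simp
  have hsq : p⁻¹ + q⁻¹ = 1 := by
    rw [← one_div, ← one_div, hpinv, hqinv, hd₁]; ring
  have hsqc : p.HolderConjugate q := Real.holderConjugate_iff.2 ⟨h1p, hsq⟩
  set β : ℝ := (3 - p) / (2 * p) with hβdef
  have hβθ : β = θ := by
    rw [hβdef, hθ, show (3 - p) / (2 * p) = 3 / 2 * (1 / p) - 1 / 2 by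
      field_simp, hpinv, hd₁]; ring
  obtain ⟨hβ0, hβ1, hr12, hrsum, hr1p, hr2p, hβinv, -, hβD⟩ := hybrid_beta_cw h1p hp3
  have h1β : 0 < 1 - β := by linarith
  have hθ0 : 0 < θ := hβθ ▸ hβ0
  have hγ0 : 0 ≤ 1 / β := by positivity
  have hγr : 1 / r * (1 / β) = 1 / (r * θ) := by rw [hβθ, one_div_mul_one_div]
  -- the Hardy–Littlewood–Sobolev constant (from `L^r`, `n = 3`)
  have hn3 : (Module.finrank ℝ (EuclideanSpace ℝ (Fin 3)) : ℝ) = 3 := by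
    rw [finrank_euclideanSpace_fin]; norm_num
  obtain ⟨Ch, hCh, hHLS⟩ := SingularIntegrals.lintegral_rieszPotential_rpow_le'
    (volume : Measure (EuclideanSpace ℝ (Fin 3))) (α := α) (p := r) hr hα0
    (by rw [hn3]; exact hαr)
  rw [hn3] at hHLS
  set L : ℝ := A * Ch.toReal * K ^ (2 - 2 * β) with hL
  have hL0 : 0 ≤ L := by positivity
  -- the Young constant (Young's inequality at `ν/4`)
  have hν4 : 0 < ν / 4 := by positivity
  set cY : ℝ := β * (2 / (ν / 4 / (2 * (1 - β))) ^ (1 - β)) ^ (1 / β) with hcY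
  have hcY0 : 0 ≤ cY := by positivity
  -- the weight: compact support and a gradient bound
  have hφc : HasCompactSupport φ := hasCompactSupport_of_tsupport_subset_closedBall_cw hφs
  have hφcont : Continuous φ := hφ.continuous
  obtain ⟨Bφ', hBφ'⟩ := (hφ.continuous_fderiv one_ne_zero).bounded_above_of_compact_support
    (hφc.fderiv (𝕜 := ℝ))
  set Bφ : ℝ := max Bφ' 0 with hBφdef
  have hBφ0 : 0 ≤ Bφ := le_max_right _ _
  have hBφ : ∀ x, ‖fderiv ℝ φ x‖ ≤ Bφ := fun x => (hBφ' x).trans (le_max_left _ _)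
  -- the measure of the big ball and the constants of the sup bound
  set mv : ℝ := (volume : Measure (EuclideanSpace ℝ (Fin 3))).real (closedBall c (6 * s)) with hmv
  have hmv0 : 0 ≤ mv := measureReal_nonneg
  set σ : ℝ := 120 * Ω * s with hσ
  set a : ℝ := CF * Real.sqrt mv with hadef
  have ha0 : 0 ≤ a := by positivity
  set C₅ : ℝ := cY * L ^ (1 / β) with hC₅
  have hC₅0 : 0 ≤ C₅ := by positivity
  refine ⟨4 * (576 * cθ ^ 2 / ν + 12 * Bφ) * σ ^ 2,
    4 * (576 * cθ ^ 2 / ν + 12 * Bφ) * a ^ 2,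
    4 * (576 * cθ ^ 2 / ν + 12 * Bφ) * a ^ 2, 8 * Ω + 12 * Bφ + ν * Bφ ^ 2 / 4, C₅,
    by positivity, by positivity, by positivity, by positivity, hC₅0, ?_⟩
  intro V hV hdiv m Mb hmm hm0 hmM hdir
  have hMb0 : 0 ≤ Mb := (hm0 c).trans (hmM c)
  -- ### basic objects
  have hV1 : ContDiff ℝ 1 V := hV.of_le (by norm_num)
  have hVc : Continuous V := hV.continuous
  have hDV : Continuous (fderiv ℝ V) := hV.continuous_fderiv (by norm_num)
  have hω1 : ContDiff ℝ 1 (curl V) := contDiff_curl (n := 1) (by exact hV)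
  have hωc : Continuous (curl V) := hω1.continuous
  have hDω : Continuous (fderiv ℝ (curl V)) := hω1.continuous_fderiv one_ne_zero
  -- geometry of the balls
  have h2s : 0 < 2 * s := by positivity
  have hs6 : s ≤ 6 * s := by linarith
  have hφx : ∀ x, φ x ≠ 0 → x ∈ closedBall c s := fun x hx => hφs (subset_tsupport _ (mem_support.2 hx))
  have hsub1 : closedBall c s ⊆ ball c (6 * s) := fun x hx => by
    rw [mem_closedBall] at hx; rw [mem_ball]; linarith
  have hsub2 : closedBall c s ⊆ closedBall c (6 * s) := closedBall_subset_closedBall hs6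
  have hsub3 : ball c (6 * s) ⊆ closedBall c (6 * s) := ball_subset_closedBall
  -- ### the quantities
  set Yφ : ℝ := ∫ x, φ x ^ 2 * ‖curl V x‖ ^ 2 with hYφ
  set Dφ : ℝ := ∫ x, φ x ^ 2 * frobeniusNormSq (fderiv ℝ (curl V) x) with hDφdef
  set D' : ℝ := ∫ x, φ x ^ 2 * ‖fderiv ℝ (curl V) x‖ ^ 2 with hD'
  set Yl : ℝ := ∫ x in closedBall c (6 * s), ‖curl V x‖ ^ 2 with hYl
  set Fl : ℝ := ∫ x in closedBall c (6 * s), ‖fderiv ℝ V x‖ ^ 2 with hFl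
  set El : ℝ := ∫ x in closedBall c (6 * s), ‖V x‖ ^ 2 with hEl
  set Ir : ℝ := ∫ x in closedBall c (6 * s), (m x * ‖curl V x‖) ^ r with hIr
  have IDφ : Integrable fun x => φ x ^ 2 * frobeniusNormSq (fderiv ℝ (curl V) x) :=
    integrable_sq_mul_of_hasCompactSupport_cw hφcont hφc (continuous_frobeniusNormSq_fderiv hω1 one_ne_zero)
  have ID' : Integrable fun x => φ x ^ 2 * ‖fderiv ℝ (curl V) x‖ ^ 2 :=
    integrable_sq_mul_of_hasCompactSupport_cw hφcont hφc (hDω.norm.pow 2)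
  have IYφ : Integrable fun x => φ x ^ 2 * ‖curl V x‖ ^ 2 :=
    integrable_sq_mul_of_hasCompactSupport_cw hφcont hφc (hωc.norm.pow 2)
  have IYl : IntegrableOn (fun x => ‖curl V x‖ ^ 2) (closedBall c (6 * s)) :=
    (hωc.norm.pow 2).continuousOn.integrableOn_compact (isCompact_closedBall _ _)
  have IFl : IntegrableOn (fun x => ‖fderiv ℝ V x‖ ^ 2) (closedBall c (6 * s)) :=
    (hDV.norm.pow 2).continuousOn.integrableOn_compact (isCompact_closedBall _ _)
  -- the weighted vorticity `m|ω|` is bounded and measurable on the compact ball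
  obtain ⟨Bω, hBω⟩ := (isCompact_closedBall c (6 * s)).exists_bound_of_continuousOn
    hωc.continuousOn
  have hBω0 : 0 ≤ Bω := (norm_nonneg _).trans (hBω c (mem_closedBall_self (by positivity)))
  have hmωm : Measurable fun x => (m x * ‖curl V x‖) ^ r :=
    (hmm.mul hωc.measurable.norm).pow_const r
  have hmω_bd : ∀ x ∈ closedBall c (6 * s), (m x * ‖curl V x‖) ^ r ≤ (Mb * Bω) ^ r := by
    intro x hx
    have h1 : m x * ‖curl V x‖ ≤ Mb * Bω :=
      mul_le_mul (hmM x) (hBω x hx) (norm_nonneg _) hMb0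
    exact Real.rpow_le_rpow (mul_nonneg (hm0 x) (norm_nonneg _)) h1 hr0.le
  have IIr : IntegrableOn (fun x => (m x * ‖curl V x‖) ^ r) (closedBall c (6 * s)) := by
    refine Measure.integrableOn_of_bounded (M := (Mb * Bω) ^ r) measure_closedBall_lt_top.ne
      hmωm.aestronglyMeasurable ?_
    refine (ae_restrict_mem measurableSet_closedBall).mono fun x hx => ?_
    rw [Real.norm_of_nonneg (Real.rpow_nonneg (mul_nonneg (hm0 x) (norm_nonneg _)) _)]
    exact hmω_bd x hx
  have hYφ0 : 0 ≤ Yφ := integral_nonneg fun x => by positivity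
  have hDφ0 : 0 ≤ Dφ := integral_nonneg fun x => mul_nonneg (sq_nonneg _) (frobeniusNormSq_nonneg _)
  have hD'0 : 0 ≤ D' := integral_nonneg fun x => by positivity
  have hYl0 : 0 ≤ Yl := setIntegral_nonneg measurableSet_closedBall fun x _ => by positivity
  have hFl0 : 0 ≤ Fl := setIntegral_nonneg measurableSet_closedBall fun x _ => by positivity
  have hEl0 : 0 ≤ El := setIntegral_nonneg measurableSet_closedBall fun x _ => by positivity
  have hIr0 : 0 ≤ Ir := setIntegral_nonneg measurableSet_closedBall fun x _ =>
    Real.rpow_nonneg (mul_nonneg (hm0 x) (norm_nonneg _)) _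
  have hD'D : D' ≤ Dφ := integral_mono ID' IDφ fun x =>
    mul_le_mul_of_nonneg_left (sq_opNorm_le_frobeniusNormSq _) (sq_nonneg _)
  set sY : ℝ := Real.sqrt Yφ with hsY
  set sL : ℝ := Real.sqrt Yl with hsL
  set sF : ℝ := Real.sqrt Fl with hsF
  set sE : ℝ := Real.sqrt El with hsE
  have hsY0 : 0 ≤ sY := Real.sqrt_nonneg _
  have hsL0 : 0 ≤ sL := Real.sqrt_nonneg _
  have hsF0 : 0 ≤ sF := Real.sqrt_nonneg _
  have hsE0 : 0 ≤ sE := Real.sqrt_nonneg _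
  have hsL2 : sL ^ 2 = Yl := Real.sq_sqrt hYl0
  have hsF2 : sF ^ 2 = Fl := Real.sq_sqrt hFl0
  have hsE2 : sE ^ 2 = El := Real.sq_sqrt hEl0
  -- the local `L^r` size of the vorticity and its power
  set Nl : ℝ := Ir ^ (1 / r) with hNl
  have hNl0 : 0 ≤ Nl := Real.rpow_nonneg hIr0 _
  set NlP : ℝ := Ir ^ (1 / (r * θ)) with hNlP
  have hNlP0 : 0 ≤ NlP := Real.rpow_nonneg hIr0 _
  have hNlγ : Nl ^ (1 / β) = NlP := by
    rw [hNl, hNlP, ← Real.rpow_mul hIr0, hγr]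
  -- ### splitting
  set R : ℝ := 2 * Ω with hRdef
  have hR : 0 < R := by positivity
  have hΩR : Ω ≤ R := by linarith
  set lo : (EuclideanSpace ℝ (Fin 3)) → (EuclideanSpace ℝ (Fin 3)) :=
    fun y => radialCutoff R (2 * R) (curl V y) • curl V y with hlo
  set hi : (EuclideanSpace ℝ (Fin 3)) → (EuclideanSpace ℝ (Fin 3)) :=
    fun y => (1 - radialCutoff R (2 * R) (curl V y)) • curl V y with hhi
  have hlohi : ∀ y, curl V y = lo y + hi y := fun y => smul_add_one_sub_smul.symm
  have hlo_le : ∀ y, ‖lo y‖ ≤ 2 * R := fun y => norm_lowPart_le hR y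
  have hhi_le : ∀ y, ‖hi y‖ ≤ ‖curl V y‖ := fun y => norm_highPart_le_norm (curl V) R y
  have hhi1 : ContDiff ℝ 1 hi := contDiff_highPart hω1 R
  have hhicont : Continuous hi := hhi1.continuous
  have hlocont : Continuous lo := (contDiff_lowPart hω1 R).continuous
  have hDhi_le : ∀ y, ‖fderiv ℝ hi y‖ ≤ cθ * ‖fderiv ℝ (curl V) y‖ := fun y =>
    norm_fderiv_highPart_le hω1 hBθ0 hBθ hR y
  -- the ball cutoff `χ` and the cut-off high part `f = χ hi`
  have hχ1 : ContDiff ℝ 1 (ballCutoff c (2 * s)) := contDiff_ballCutoff c (2 * s)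
  have hχc : HasCompactSupport (ballCutoff c (2 * s)) := hasCompactSupport_ballCutoff h2s
  have hχ01 : ∀ y, 0 ≤ ballCutoff c (2 * s) y ∧ ballCutoff c (2 * s) y ≤ 1 := fun y =>
    ⟨ballCutoff_nonneg _ _ _, ballCutoff_le_one _ _ _⟩
  have hχO : support (ballCutoff c (2 * s)) ⊆ ball c (6 * s) := by
    intro y hy
    by_contra h
    rw [mem_ball, dist_eq_norm, not_lt] at h
    exact hy (ballCutoff_eq_zero h2s (by linarith))
  set f : (EuclideanSpace ℝ (Fin 3)) → (EuclideanSpace ℝ (Fin 3)) :=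
    fun y => ballCutoff c (2 * s) y • hi y with hfdef
  have hf1 : ContDiff ℝ 1 f := hχ1.smul hhi1
  have hfc : HasCompactSupport f := hχc.smul_right
  have hfcont : Continuous f := hf1.continuous
  have hf_le : ∀ y, ‖f y‖ ≤ ‖curl V y‖ := fun y => by
    show ‖ballCutoff c (2 * s) y • hi y‖ ≤ ‖curl V y‖
    rw [norm_smul, Real.norm_eq_abs, abs_of_nonneg (hχ01 y).1]
    calc ballCutoff c (2 * s) y * ‖hi y‖ ≤ 1 * ‖curl V y‖ :=
          mul_le_mul (hχ01 y).2 (hhi_le y) (norm_nonneg _) zero_le_one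
      _ = ‖curl V y‖ := one_mul _
  have hf0 : ∀ y, y ∉ closedBall c (6 * s) → f y = 0 := fun y hy => by
    have : ballCutoff c (2 * s) y = 0 := by
      by_contra h
      exact hy (hsub3 (hχO (mem_support.2 h)))
    show ballCutoff c (2 * s) y • hi y = 0
    rw [this, zero_smul]
  obtain ⟨Cl, hCl⟩ := hf1.lipschitzWith_of_hasCompactSupport hfc one_ne_zero
  have hhol : HolderWith Cl 1 f := hCl.holderWith
  have hKf1 : ContDiff ℝ 1 (biotSavart f) := contDiff_biotSavart one_pos hhol hfc
  set U : (EuclideanSpace ℝ (Fin 3)) → (EuclideanSpace ℝ (Fin 3)) := fun x => V x - biotSavart f x with hU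
  have hU1 : ContDiff ℝ 1 U := hV1.sub hKf1
  have hDU : ∀ x, fderiv ℝ U x = fderiv ℝ V x - fderiv ℝ (biotSavart f) x := fun x =>
    fderiv_fun_sub ((hV1.differentiable one_ne_zero) x) ((hKf1.differentiable one_ne_zero) x)
  -- ### the sup bound for `U` on `B(c, 3s)` and the globally bounded `Ũ = θ U`
  set I : ℝ := ∫ y in closedBall c (6 * s), (‖curl V y‖ + ‖fderiv ℝ V y‖ + ‖V y‖) with hIdef
  have hI0 : 0 ≤ I := setIntegral_nonneg measurableSet_closedBall fun y _ => by positivity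
  set S : ℝ := 30 * (2 * R) * s + CF * I with hSdef
  have hS : ∀ x ∈ ball c (3 * s), ‖U x‖ ≤ S := by
    intro x hx
    have hΛ : ∀ y ∈ ball c (6 * s), ‖curl V y - hi y‖ ≤ 2 * R := fun y _ => by
      have e : curl V y - hi y = lo y := by rw [hlohi y]; abel
      rw [e]; exact hlo_le y
    exact hsupF hV hdiv hhicont hΛ hx
  have hS0 : 0 ≤ S := by positivity
  have hIle : I ≤ Real.sqrt mv * (sL + sF + sE) := by
    have h1 := setIntegral_closedBall_le_sqrt_vol_mul_sqrt_cw hωc.norm (fun x => norm_nonneg _) c (6 * s)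
    have h2 := setIntegral_closedBall_le_sqrt_vol_mul_sqrt_cw hDV.norm (fun x => norm_nonneg _) c (6 * s)
    have h3 := setIntegral_closedBall_le_sqrt_vol_mul_sqrt_cw hVc.norm (fun x => norm_nonneg _) c (6 * s)
    have Iω : IntegrableOn (fun y => ‖curl V y‖) (closedBall c (6 * s)) :=
      hωc.norm.continuousOn.integrableOn_compact (isCompact_closedBall _ _)
    have IDv : IntegrableOn (fun y => ‖fderiv ℝ V y‖) (closedBall c (6 * s)) :=
      hDV.norm.continuousOn.integrableOn_compact (isCompact_closedBall _ _)
    have Iv : IntegrableOn (fun y => ‖V y‖) (closedBall c (6 * s)) :=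
      hVc.norm.continuousOn.integrableOn_compact (isCompact_closedBall _ _)
    have I2 : IntegrableOn (fun y => ‖curl V y‖ + ‖fderiv ℝ V y‖) (closedBall c (6 * s)) := Iω.add IDv
    have hsplit : I = (∫ y in closedBall c (6 * s), ‖curl V y‖) +
        (∫ y in closedBall c (6 * s), ‖fderiv ℝ V y‖) + ∫ y in closedBall c (6 * s), ‖V y‖ := by
      rw [hIdef, integral_add I2 Iv, integral_add Iω IDv]
    rw [hsplit]
    have e : Real.sqrt mv * (sL + sF + sE) = Real.sqrt mv * sL + Real.sqrt mv * sF + Real.sqrt mv * sE := by ring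
    rw [e]
    exact add_le_add (add_le_add h1 h2) h3
  set S' : ℝ := σ + a * (sL + sF + sE) with hS'
  have hSS' : S ≤ S' := by
    have h1 : CF * I ≤ CF * (Real.sqrt mv * (sL + sF + sE)) := mul_le_mul_of_nonneg_left hIle hCF0
    have e : 30 * (2 * R) * s = σ := by rw [hσ, hRdef]; ring
    have e2 : CF * (Real.sqrt mv * (sL + sF + sE)) = a * (sL + sF + sE) := by rw [hadef]; ring
    rw [hSdef, hS', e]
    linarith
  have hS'0 : 0 ≤ S' := hS0.trans hSS'
  have hS'sq : S' ^ 2 ≤ 4 * (σ ^ 2 + a ^ 2 * (Yl + Fl + El)) := by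
    have h : S' ^ 2 ≤ 4 * (σ ^ 2 + (a * sL) ^ 2 + (a * sF) ^ 2 + (a * sE) ^ 2) := by
      rw [hS']
      nlinarith only [sq_nonneg (σ - a * sL), sq_nonneg (σ - a * sF), sq_nonneg (σ - a * sE),
        sq_nonneg (a * sL - a * sF), sq_nonneg (a * sL - a * sE), sq_nonneg (a * sF - a * sE)]
    calc S' ^ 2 ≤ 4 * (σ ^ 2 + (a * sL) ^ 2 + (a * sF) ^ 2 + (a * sE) ^ 2) := h
      _ = 4 * (σ ^ 2 + a ^ 2 * (Yl + Fl + El)) := by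
          simp only [mul_pow, hsL2, hsF2, hsE2]; ring
  have hθ1 : ContDiff ℝ 1 (ballCutoff c s) := contDiff_ballCutoff c s
  have hθ01 : ∀ y, 0 ≤ ballCutoff c s y ∧ ballCutoff c s y ≤ 1 := fun y =>
    ⟨ballCutoff_nonneg _ _ _, ballCutoff_le_one _ _ _⟩
  set Ut : (EuclideanSpace ℝ (Fin 3)) → (EuclideanSpace ℝ (Fin 3)) := fun x => ballCutoff c s x • U x with hUt
  have hUt1 : ContDiff ℝ 1 Ut := hθ1.smul hU1
  have hUtS : ∀ x, ‖Ut x‖ ≤ S := by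
    intro x
    show ‖ballCutoff c s x • U x‖ ≤ S
    rw [norm_smul, Real.norm_eq_abs, abs_of_nonneg (hθ01 x).1]
    by_cases hx : x ∈ ball c (3 * s)
    · calc ballCutoff c s x * ‖U x‖ ≤ 1 * S := mul_le_mul (hθ01 x).2 (hS x hx) (norm_nonneg _) zero_le_one
        _ = S := one_mul _
    · have : ballCutoff c s x = 0 := by
        rw [mem_ball, dist_eq_norm, not_lt] at hx
        exact ballCutoff_eq_zero hs hx
      rw [this, zero_mul]; exact hS0
  -- `DŨ = DU` near the support of `φ`
  have hDUt : ∀ x, φ x ≠ 0 → fderiv ℝ Ut x = fderiv ℝ U x := by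
    intro x hx
    have hxs : x ∈ ball c (2 * s) := by
      have := hφx x hx; rw [mem_closedBall] at this; rw [mem_ball]; linarith
    have hev : Ut =ᶠ[𝓝 x] U := by
      filter_upwards [ballCutoff_eventuallyEq_one hs hxs] with y hy
      show ballCutoff c s y • U y = U y
      rw [hy, one_smul]
    exact hev.fderiv_eq
  -- ### the pointwise decomposition of the stretching density
  set Et : (EuclideanSpace ℝ (Fin 3)) → ℝ := fun x =>
    φ x ^ 2 * (⟪lo x, fderiv ℝ V x (curl V x)⟫ + ⟪hi x, fderiv ℝ V x (lo x)⟫) with hEt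
  set Bt : (EuclideanSpace ℝ (Fin 3)) → ℝ := fun x => ⟪φ x • hi x, fderiv ℝ Ut x (φ x • hi x)⟫ with hBt
  set Gt : (EuclideanSpace ℝ (Fin 3)) → ℝ := fun x =>
    φ x ^ 2 * ⟪hi x, fderiv ℝ (biotSavart f) x (hi x)⟫ with hGt
  have hsplit : ∀ x, φ x ^ 2 * ⟪curl V x, fderiv ℝ V x (curl V x)⟫ = Et x + (Bt x + Gt x) := by
    intro x
    by_cases hφ0 : φ x = 0
    · have e1 : Et x = 0 := by rw [hEt]; simp only; rw [hφ0]; ring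
      have e2 : Bt x = 0 := by rw [hBt]; simp only; rw [hφ0, zero_smul, inner_zero_left]
      have e3 : Gt x = 0 := by rw [hGt]; simp only; rw [hφ0]; ring
      rw [e1, e2, e3, hφ0]; ring
    have h1 : Bt x + Gt x = φ x ^ 2 * ⟪hi x, fderiv ℝ V x (hi x)⟫ := by
      show ⟪φ x • hi x, fderiv ℝ Ut x (φ x • hi x)⟫ +
          φ x ^ 2 * ⟪hi x, fderiv ℝ (biotSavart f) x (hi x)⟫ = _
      rw [hDUt x hφ0, map_smul, real_inner_smul_left, real_inner_smul_right, hDU x,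
        sub_apply, inner_sub_right]
      ring
    rw [h1]
    show φ x ^ 2 * ⟪curl V x, fderiv ℝ V x (curl V x)⟫ =
      φ x ^ 2 * (⟪lo x, fderiv ℝ V x (curl V x)⟫ + ⟪hi x, fderiv ℝ V x (lo x)⟫) +
        φ x ^ 2 * ⟪hi x, fderiv ℝ V x (hi x)⟫
    have hω' := hlohi x
    have e : ⟪curl V x, fderiv ℝ V x (curl V x)⟫ =
        (⟪lo x, fderiv ℝ V x (curl V x)⟫ + ⟪hi x, fderiv ℝ V x (lo x)⟫) + ⟪hi x, fderiv ℝ V x (hi x)⟫ := by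
      rw [hω']
      simp only [map_add, inner_add_left, inner_add_right]
      ring
    rw [e]; ring
  -- integrability of the three pieces
  have hEt_pt : ∀ x, |Et x| ≤ φ x ^ 2 * (2 * R * (‖fderiv ℝ V x‖ ^ 2 + ‖curl V x‖ ^ 2)) := by
    intro x
    rw [hEt]
    simp only
    rw [abs_mul, abs_of_nonneg (sq_nonneg _)]
    exact mul_le_mul_of_nonneg_left
      (abs_inner_low_terms_le (fderiv ℝ V x) (by positivity) (hlo_le x) (hhi_le x)) (sq_nonneg _)
  have Idom : Integrable fun x => φ x ^ 2 * (2 * R * (‖fderiv ℝ V x‖ ^ 2 + ‖curl V x‖ ^ 2)) :=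
    integrable_sq_mul_of_hasCompactSupport_cw hφcont hφc
      (continuous_const.mul ((hDV.norm.pow 2).add (hωc.norm.pow 2)))
  have IEt : Integrable Et := by
    have hcont : Continuous Et := (hφcont.pow 2).mul
      ((hlocont.inner (hDV.clm_apply hωc)).add (hhicont.inner (hDV.clm_apply hlocont)))
    refine Idom.mono' hcont.aestronglyMeasurable (Eventually.of_forall fun x => ?_)
    rw [Real.norm_eq_abs]
    exact hEt_pt x
  have hZ1 : ContDiff ℝ 1 (fun x => φ x • hi x) := hφ.smul hhi1
  have hZc : HasCompactSupport (fun x => φ x • hi x) := hφc.smul_right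
  have hZcont : Continuous (fun x => φ x • hi x) := hZ1.continuous
  have IBt : Integrable Bt := by
    refine (hZcont.inner ((hUt1.continuous_fderiv one_ne_zero).clm_apply hZcont)).integrable_of_hasCompactSupport ?_
    refine hZc.mono fun x hx => ?_
    rw [mem_support] at hx ⊢
    intro h
    apply hx
    show ⟪φ x • hi x, fderiv ℝ Ut x (φ x • hi x)⟫ = 0
    rw [h, inner_zero_left]
  have IGt : Integrable Gt :=
    integrable_sq_mul_of_hasCompactSupport_cw hφcont hφc
      (hhicont.inner ((hKf1.continuous_fderiv one_ne_zero).clm_apply hhicont))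
  have IBG : Integrable fun x => Bt x + Gt x := IBt.add IGt
  have hP : ∫ x, φ x ^ 2 * ⟪curl V x, fderiv ℝ V x (curl V x)⟫ =
      (∫ x, Et x) + ((∫ x, Bt x) + ∫ x, Gt x) := by
    rw [← integral_add IBt IGt, ← integral_add IEt IBG]
    exact integral_congr_ae (Eventually.of_forall hsplit)
  -- ### bound of the low terms
  have hTE : 2 * ∫ x, Et x ≤ 8 * Ω * (Fl + Yl) := by
    have h1 : ∫ x, Et x ≤ ∫ x, φ x ^ 2 * (2 * R * (‖fderiv ℝ V x‖ ^ 2 + ‖curl V x‖ ^ 2)) :=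
      integral_mono IEt Idom fun x => (le_abs_self _).trans (hEt_pt x)
    have h2 : ∫ x, φ x ^ 2 * (2 * R * (‖fderiv ℝ V x‖ ^ 2 + ‖curl V x‖ ^ 2)) ≤
        ∫ x in closedBall c (6 * s), 2 * R * (‖fderiv ℝ V x‖ ^ 2 + ‖curl V x‖ ^ 2) :=
      integral_sq_mul_le_setIntegral_cw hφcont hφ01 (hφs.trans hsub2)
        (continuous_const.mul ((hDV.norm.pow 2).add (hωc.norm.pow 2))) fun x => by positivity
    have h3 : ∫ x in closedBall c (6 * s), 2 * R * (‖fderiv ℝ V x‖ ^ 2 + ‖curl V x‖ ^ 2) =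
        2 * R * (Fl + Yl) := by
      rw [integral_const_mul, integral_add IFl IYl]
    have e : 2 * (2 * R * (Fl + Yl)) = 8 * Ω * (Fl + Yl) := by rw [hRdef]; ring
    linarith
  -- ### bound of the `U` term by integration by parts
  have hTB : ∫ x, Bt x ≤ 12 * cθ * S' * Real.sqrt Yφ * Real.sqrt D' + 6 * Bφ * (S' ^ 2 * Yφ + Yl) := by
    have h := integral_inner_smul_fderiv_smul_le_cw hφ hφ01 hφs hs6 hBφ0 hBφ hω1 hhi1 hhi_le hcθ0
      hDhi_le hUt1 hS0 hUtS
    have h' : ∫ x, Bt x ≤ 12 * cθ * S * Real.sqrt Yφ * Real.sqrt D' + 6 * Bφ * (S ^ 2 * Yφ + Yl) := h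
    have e1 : 12 * cθ * S * Real.sqrt Yφ * Real.sqrt D' ≤ 12 * cθ * S' * Real.sqrt Yφ * Real.sqrt D' := by
      have : 0 ≤ 12 * cθ := by positivity
      have : 0 ≤ 12 * cθ * Real.sqrt Yφ * Real.sqrt D' := by positivity
      nlinarith only [hSS', this]
    have e2 : S ^ 2 * Yφ ≤ S' ^ 2 * Yφ := mul_le_mul_of_nonneg_right (pow_le_pow_left₀ hS0 hSS' 2) hYφ0
    have e3 := mul_le_mul_of_nonneg_left (add_le_add_right e2 Yl) (by positivity : (0:ℝ) ≤ 6 * Bφ)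
    linarith only [h', e1, e3]
  -- ### bound of the high term: depletion, Hölder, Hardy–Littlewood–Sobolev, interpolation
  have hGpt : ∀ x, |Gt x| ≤
      φ x ^ 2 * (A * ‖curl V x‖ ^ 2 * ∫ y, ‖x - y‖ ^ (α - 3) * (m y * ‖f y‖)) := by
    intro x
    rw [hGt]
    simp only
    rw [abs_mul, abs_of_nonneg (sq_nonneg _)]
    by_cases hφ0 : φ x = 0
    · rw [hφ0]; simp
    · have hxO : x ∈ ball c (6 * s) := hsub1 (hφx x hφ0)
      exact mul_le_mul_of_nonneg_left
        (hdep hω1 hR hΩR hα0 hmm hm0 hmM hχ1 hχc (fun y => (hχ01 y).1) hχO hdir hxO) (sq_nonneg _)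
  -- the weighted field `W = φ ω` and its Sobolev bound
  set W : (EuclideanSpace ℝ (Fin 3)) → (EuclideanSpace ℝ (Fin 3)) := fun x => φ x • curl V x with hW
  have hW1 : ContDiff ℝ 1 W := hφ.smul hω1
  have hWc : HasCompactSupport W := hφc.smul_right
  have hWcont : Continuous W := hW1.continuous
  have hDWc : Continuous (fderiv ℝ W) := hW1.continuous_fderiv one_ne_zero
  have hWnorm : ∀ x, ‖W x‖ = φ x * ‖curl V x‖ := fun x => by
    show ‖φ x • curl V x‖ = _; rw [norm_smul, Real.norm_eq_abs, abs_of_nonneg (hφ01 x).1]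
  have IW2 : Integrable fun x => ‖W x‖ ^ 2 := by
    have e : (fun x => ‖W x‖ ^ 2) = fun x => φ x ^ 2 * ‖curl V x‖ ^ 2 := by
      funext x; rw [hWnorm x]; ring
    rw [e]; exact IYφ
  have hW2 : ∫ x, ‖W x‖ ^ 2 = Yφ := by
    rw [hYφ]; exact integral_congr_ae (Eventually.of_forall fun x => by
      show ‖W x‖ ^ 2 = φ x ^ 2 * ‖curl V x‖ ^ 2; rw [hWnorm x]; ring)
  have hWm2 : MemLp W 2 volume := (memLp_two_iff_integrable_sq_norm hWcont.aestronglyMeasurable).2 IW2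
  obtain ⟨IDW2, hDW2⟩ := integral_norm_fderiv_smul_sq_le_cw hφ hφ01 hφs hs6 hBφ hω1
  set X2 : ℝ := 2 * D' + 2 * Bφ ^ 2 * Yl with hX2
  have hX20 : 0 ≤ X2 := by positivity
  set sX : ℝ := Real.sqrt X2 with hsX
  have hsX0 : 0 ≤ sX := Real.sqrt_nonneg _
  have hKsX : 0 ≤ K * sX := mul_nonneg hK0.le hsX0
  have hDW2' : ∫ x, ‖fderiv ℝ W x‖ ^ 2 ≤ X2 := hDW2
  have hDWm2 : MemLp (fderiv ℝ W) 2 volume :=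
    (memLp_two_iff_integrable_sq_norm hDWc.aestronglyMeasurable).2 IDW2
  have hDW2r : (eLpNorm (fderiv ℝ W) 2 volume).toReal ≤ sX := by
    rw [toReal_eLpNorm_two_eq_sqrt hDWc IDW2, hsX]
    exact Real.sqrt_le_sqrt hDW2'
  have hsob := eLpNorm_six_le_eLpNorm_fderiv_two (volume : Measure (EuclideanSpace ℝ (Fin 3)))
    (F := (EuclideanSpace ℝ (Fin 3))) finrank_euclideanSpace_fin hW1 hWm2.eLpNorm_lt_top
  have hDW_eq : eLpNorm (fderiv ℝ W) 2 volume = ENNReal.ofReal ((eLpNorm (fderiv ℝ W) 2 volume).toReal) :=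
    (ENNReal.ofReal_toReal hDWm2.eLpNorm_lt_top.ne).symm
  have hK₀K : (K₀ : ℝ≥0∞) ≤ ENNReal.ofReal K := by
    rw [hK, show ((K₀ : ℝ) + 1 : ℝ) = ((K₀ + 1 : ℝ≥0) : ℝ) by push_cast; ring,
      ENNReal.ofReal_coe_nnreal]
    exact_mod_cast le_self_add
  have hW6e : eLpNorm W 6 volume ≤ ENNReal.ofReal (K * sX) := by
    refine hsob.trans ?_
    rw [hDW_eq, ENNReal.ofReal_mul hK0.le]
    exact mul_le_mul' hK₀K (ENNReal.ofReal_le_ofReal hDW2r)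
  -- the high term before Young: `∫ G ≤ X · X2^{1−β}`, `X = L N Yφ^β`
  set X : ℝ := L * Nl * Yφ ^ β with hXdef
  have hX0 : 0 ≤ X := by positivity
  have hTG1 : ∫ x, Gt x ≤ X * X2 ^ (1 - β) := by
    -- (i) `∫ G ≤ ∫ |G| = (∫⁻ ‖G‖ₑ).toReal`
    have h1 : ∫ x, Gt x ≤ ∫ x, ‖Gt x‖ := integral_mono IGt IGt.norm fun x => le_abs_self _
    rw [integral_norm_eq_lintegral_enorm IGt.aestronglyMeasurable] at h1
    -- (ii) the `ℝ≥0∞` objects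
    set Φ : (EuclideanSpace ℝ (Fin 3)) → ℝ≥0∞ := fun x => ‖W x‖ₑ ^ 2 with hΦ
    set Fh : (EuclideanSpace ℝ (Fin 3)) → ℝ≥0∞ := fun y => ENNReal.ofReal (m y) * ‖f y‖ₑ with hFh
    have hΦm : Measurable Φ := hWcont.measurable.enorm.pow_const 2
    have hFm : Measurable Fh := hmm.ennreal_ofReal.mul hfcont.measurable.enorm
    set Pe : (EuclideanSpace ℝ (Fin 3)) → ℝ≥0∞ := SingularIntegrals.rieszPotential volume α Fh
      with hPe
    have hPem : Measurable Pe := SingularIntegrals.measurable_rieszPotential volume α hFm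
    have hPint : ∀ x, Integrable fun y => ‖x - y‖ ^ (α - 3) * (m y * ‖f y‖) := by
      intro x
      have hk : Integrable fun y => ‖x - y‖ ^ (α - 3) * ‖f y‖ :=
        integrable_rieszKernel_mul_norm_cw hα0 hfcont hfc x
      have hmk : Integrable fun y => m y * (‖x - y‖ ^ (α - 3) * ‖f y‖) :=
        hk.bdd_mul hmm.aestronglyMeasurable (Eventually.of_forall fun y => by
          rw [Real.norm_of_nonneg (hm0 y)]; exact hmM y)
      refine hmk.congr (Eventually.of_forall fun y => ?_)
      show m y * (‖x - y‖ ^ (α - 3) * ‖f y‖) = ‖x - y‖ ^ (α - 3) * (m y * ‖f y‖)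
      ring
    have hPeq : ∀ x, ENNReal.ofReal (∫ y, ‖x - y‖ ^ (α - 3) * (m y * ‖f y‖)) = Pe x := by
      intro x
      rw [ofReal_integral_eq_lintegral_ofReal (hPint x) (Eventually.of_forall fun y =>
        mul_nonneg (Real.rpow_nonneg (norm_nonneg _) _) (mul_nonneg (hm0 y) (norm_nonneg _))), hPe,
        SingularIntegrals.rieszPotential_def, hn3]
      refine lintegral_congr fun y => ?_
      rw [ENNReal.ofReal_mul (Real.rpow_nonneg (norm_nonneg _) _), ENNReal.ofReal_mul (hm0 y),
        ofReal_norm, mul_comm]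
    have hpt : ∀ x, ‖Gt x‖ₑ ≤ ENNReal.ofReal A * (Φ x * Pe x) := by
      intro x
      rw [Real.enorm_eq_ofReal_abs]
      refine (ENNReal.ofReal_le_ofReal (hGpt x)).trans (le_of_eq ?_)
      have e : φ x ^ 2 * (A * ‖curl V x‖ ^ 2 * ∫ y, ‖x - y‖ ^ (α - 3) * (m y * ‖f y‖)) =
          A * (‖W x‖ ^ 2 * ∫ y, ‖x - y‖ ^ (α - 3) * (m y * ‖f y‖)) := by
        rw [hWnorm x]; ring
      rw [e, ENNReal.ofReal_mul hA0, ENNReal.ofReal_mul (by positivity : 0 ≤ ‖W x‖ ^ 2), hPeq x, hΦ]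
      simp only
      rw [ENNReal.ofReal_pow (norm_nonneg _), ofReal_norm]
    have h2 : ∫⁻ x, ‖Gt x‖ₑ ≤ ENNReal.ofReal A * ∫⁻ x, Φ x * Pe x := by
      calc ∫⁻ x, ‖Gt x‖ₑ ≤ ∫⁻ x, ENNReal.ofReal A * (Φ x * Pe x) := lintegral_mono hpt
        _ = ENNReal.ofReal A * ∫⁻ x, Φ x * Pe x := lintegral_const_mul' _ _ ENNReal.ofReal_ne_top
    -- (iii) Hölder `(p, q)` (Grujić–Zhang (3.8))
    have h3 : ∫⁻ x, Φ x * Pe x ≤ (∫⁻ x, Φ x ^ p) ^ (1 / p) * (∫⁻ x, Pe x ^ q) ^ (1 / q) := by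
      have h := ENNReal.lintegral_mul_le_Lp_mul_Lq volume hsqc hΦm.aemeasurable hPem.aemeasurable
      simpa only [Pi.mul_apply] using h
    -- (iv) `‖|W|²‖_p = ‖W‖²_{2p} ≤ ‖W‖₂^{2β} ‖W‖₆^{2−2β} ≤ Yφ^β (K sX)^{2−2β}` (their (3.9))
    have h6 : (∫⁻ x, Φ x ^ p) ^ (1 / p) ≤ ENNReal.ofReal (Yφ ^ β * (K * sX) ^ (2 - 2 * β)) := by
      have hΦp : ∀ x, Φ x ^ p = ‖W x‖ₑ ^ (2 / (2 / (3 - p)) + 6 / (2 / (p - 1))) :=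
        fun x => by
          rw [hΦ]; simp only
          rw [← ENNReal.rpow_natCast, ← ENNReal.rpow_mul, hrsum]
      simp_rw [hΦp]
      have hint := lintegral_enorm_rpow_le_interp_cw volume (f := W) hWcont.aestronglyMeasurable hr12
      -- `∫‖W‖ₑ² = Yφ`
      have hY2 : ∫⁻ x, ‖W x‖ₑ ^ (2 : ℝ) = ENNReal.ofReal Yφ := by
        rw [← hW2, ofReal_integral_eq_lintegral_ofReal IW2
          (Eventually.of_forall fun x => sq_nonneg _)]
        refine lintegral_congr fun x => ?_
        rw [show (2 : ℝ) = ((2 : ℕ) : ℝ) by norm_num, ENNReal.rpow_natCast,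
          ENNReal.ofReal_pow (norm_nonneg _), ofReal_norm]
      -- `∫‖W‖ₑ⁶ ≤ (K sX)⁶`
      have hY6 : ∫⁻ x, ‖W x‖ₑ ^ (6 : ℝ) ≤ ENNReal.ofReal ((K * sX) ^ 6) := by
        have hrepr := eLpNorm_eq_lintegral_rpow_enorm_toReal (μ := volume) (f := W)
          (by norm_num : (6 : ℝ≥0∞) ≠ 0) (by norm_num : (6 : ℝ≥0∞) ≠ ⊤)
        have h6r : (6 : ℝ≥0∞).toReal = 6 := by norm_num
        rw [h6r] at hrepr
        have hI : ∫⁻ x, ‖W x‖ₑ ^ (6 : ℝ) = eLpNorm W 6 volume ^ (6 : ℝ) := by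
          rw [hrepr, ← ENNReal.rpow_mul]; norm_num
        rw [hI, show (6 : ℝ) = ((6 : ℕ) : ℝ) by norm_num, ENNReal.rpow_natCast,
          ENNReal.ofReal_pow hKsX]
        exact pow_le_pow_left' hW6e 6
      have hr1nn : 0 ≤ 1 / (2 / (3 - p)) := by positivity
      have hr2nn : 0 ≤ 1 / (2 / (p - 1)) := le_of_lt hr12.symm.one_div_pos
      have hA' : (∫⁻ x, ‖W x‖ₑ ^ (2 : ℝ)) ^ (1 / (2 / (3 - p))) =
          ENNReal.ofReal (Yφ ^ (1 / (2 / (3 - p)))) := by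
        rw [hY2, ENNReal.ofReal_rpow_of_nonneg hYφ0 hr1nn]
      have hB' : (∫⁻ x, ‖W x‖ₑ ^ (6 : ℝ)) ^ (1 / (2 / (p - 1))) ≤
          ENNReal.ofReal (((K * sX) ^ 6) ^ (1 / (2 / (p - 1)))) := by
        rw [← ENNReal.ofReal_rpow_of_nonneg (by positivity) hr2nn]
        exact ENNReal.rpow_le_rpow hY6 hr2nn
      have hle : ∫⁻ x, ‖W x‖ₑ ^ (2 / (2 / (3 - p)) + 6 / (2 / (p - 1))) ≤
          ENNReal.ofReal (Yφ ^ (1 / (2 / (3 - p))) * ((K * sX) ^ 6) ^ (1 / (2 / (p - 1)))) := by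
        rw [ENNReal.ofReal_mul (Real.rpow_nonneg hYφ0 _)]
        refine hint.trans ?_
        rw [hA']
        exact mul_le_mul' le_rfl hB'
      have hreal : (Yφ ^ (1 / (2 / (3 - p))) * ((K * sX) ^ 6) ^ (1 / (2 / (p - 1)))) ^ (1 / p) =
          Yφ ^ β * (K * sX) ^ (2 - 2 * β) := by
        have ha : (0 : ℝ) ≤ Yφ ^ (1 / (2 / (3 - p))) := Real.rpow_nonneg hYφ0 _
        have hb6 : (0 : ℝ) ≤ (K * sX) ^ 6 := pow_nonneg hKsX 6
        have hb' : (0 : ℝ) ≤ ((K * sX) ^ 6) ^ (1 / (2 / (p - 1))) := Real.rpow_nonneg hb6 _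
        rw [Real.mul_rpow ha hb', ← Real.rpow_mul hYφ0, hr1p, ← Real.rpow_mul hb6,
          show ((K * sX) ^ 6 : ℝ) = (K * sX) ^ ((6 : ℕ) : ℝ) by rw [Real.rpow_natCast],
          ← Real.rpow_mul hKsX, hr2p]
      calc (∫⁻ x, ‖W x‖ₑ ^ (2 / (2 / (3 - p)) + 6 / (2 / (p - 1)))) ^ (1 / p)
          ≤ (ENNReal.ofReal (Yφ ^ (1 / (2 / (3 - p))) *
              ((K * sX) ^ 6) ^ (1 / (2 / (p - 1))))) ^ (1 / p) :=
            ENNReal.rpow_le_rpow hle (by positivity)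
        _ = ENNReal.ofReal (Yφ ^ β * (K * sX) ^ (2 - 2 * β)) := by
            rw [ENNReal.ofReal_rpow_of_nonneg (by positivity) (by positivity), hreal]
    -- (v) Hardy–Littlewood–Sobolev from `L^r(B̄(c,6s))`: `‖I_α(m|f|)‖_q ≤ C_h ‖m f‖_r ≤ C_h N`
    have h7 : (∫⁻ x, Pe x ^ q) ^ (1 / q) ≤ Ch * ENNReal.ofReal Nl := by
      have h := hHLS Fh hFm.aemeasurable
      refine h.trans (mul_le_mul' le_rfl ?_)
      have hmono : ∫⁻ y, Fh y ^ r ≤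
          ∫⁻ y, (closedBall c (6 * s)).indicator
            (fun y => (ENNReal.ofReal (m y) * ‖curl V y‖ₑ) ^ r) y := by
        refine lintegral_mono fun y => ?_
        by_cases hy : y ∈ closedBall c (6 * s)
        · rw [indicator_of_mem hy, hFh]; simp only
          rw [← ofReal_norm, ← ofReal_norm]
          exact ENNReal.rpow_le_rpow (mul_le_mul' le_rfl (ENNReal.ofReal_le_ofReal (hf_le y))) hr0.le
        · rw [indicator_of_notMem hy, hFh]; simp only
          rw [hf0 y hy, enorm_zero, mul_zero, ENNReal.zero_rpow_of_pos hr0]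
      have hIre : ∫⁻ y in closedBall c (6 * s), (ENNReal.ofReal (m y) * ‖curl V y‖ₑ) ^ r =
          ENNReal.ofReal Ir := by
        rw [hIr, ofReal_integral_eq_lintegral_ofReal IIr (Eventually.of_forall fun y =>
          Real.rpow_nonneg (mul_nonneg (hm0 y) (norm_nonneg _)) _)]
        refine lintegral_congr fun y => ?_
        rw [← ofReal_norm, ← ENNReal.ofReal_mul (hm0 y),
          ENNReal.ofReal_rpow_of_nonneg (mul_nonneg (hm0 y) (norm_nonneg _)) hr0.le]
      calc (∫⁻ y, Fh y ^ r) ^ (1 / r)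
          ≤ (∫⁻ y, (closedBall c (6 * s)).indicator
              (fun y => (ENNReal.ofReal (m y) * ‖curl V y‖ₑ) ^ r) y) ^ (1 / r) :=
            ENNReal.rpow_le_rpow hmono (by positivity)
        _ = (ENNReal.ofReal Ir) ^ (1 / r) := by
            rw [lintegral_indicator measurableSet_closedBall, hIre]
        _ = ENNReal.ofReal Nl := by
            rw [hNl, ENNReal.ofReal_rpow_of_nonneg hIr0 (by positivity)]
    -- (vi) assemble in `ℝ≥0∞`, then pass to `ℝ`
    have h8 : ∫⁻ x, Φ x * Pe x ≤
        ENNReal.ofReal (Yφ ^ β * (K * sX) ^ (2 - 2 * β)) * (Ch * ENNReal.ofReal Nl) :=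
      h3.trans (mul_le_mul' h6 h7)
    have hChe : Ch = ENNReal.ofReal Ch.toReal := (ENNReal.ofReal_toReal hCh.ne).symm
    have hYβ0 : 0 ≤ Yφ ^ β * (K * sX) ^ (2 - 2 * β) :=
      mul_nonneg (Real.rpow_nonneg hYφ0 _) (Real.rpow_nonneg hKsX _)
    have h9 : (∫⁻ x, ‖Gt x‖ₑ).toReal ≤
        A * ((Yφ ^ β * (K * sX) ^ (2 - 2 * β)) * (Ch.toReal * Nl)) := by
      have h := h2.trans (mul_le_mul' le_rfl h8)
      rw [hChe, ← ENNReal.ofReal_mul ENNReal.toReal_nonneg,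
        ← ENNReal.ofReal_mul hYβ0, ← ENNReal.ofReal_mul hA0] at h
      have h' := ENNReal.toReal_mono ENNReal.ofReal_ne_top h
      rwa [ENNReal.toReal_ofReal (by positivity)] at h'
    -- (vii) `A Yφ^β (K sX)^{2−2β} C_h N = X · X2^{1−β}`
    have hKsXsplit : (K * sX) ^ (2 - 2 * β) = K ^ (2 - 2 * β) * sX ^ (2 - 2 * β) :=
      Real.mul_rpow hK0.le hsX0
    have hsXpow : sX ^ (2 - 2 * β) = X2 ^ (1 - β) := by
      rw [hsX, Real.sqrt_eq_rpow, ← Real.rpow_mul hX20, hβD]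
    have hform : A * ((Yφ ^ β * (K * sX) ^ (2 - 2 * β)) * (Ch.toReal * Nl)) =
        X * X2 ^ (1 - β) := by
      rw [hKsXsplit, hsXpow, hXdef, hL]; ring
    calc ∫ x, Gt x ≤ (∫⁻ x, ‖Gt x‖ₑ).toReal := h1
      _ ≤ A * ((Yφ ^ β * (K * sX) ^ (2 - 2 * β)) * (Ch.toReal * Nl)) := h9
      _ = X * X2 ^ (1 - β) := hform
  -- ### Young with exponents `1/(1−β)`, `1/β` at `ν/4`
  have hTG : 2 * ∫ x, Gt x ≤ ν / 4 * D' + ν / 4 * Bφ ^ 2 * Yl + (C₅ * NlP) * Yφ := by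
    have hy := two_mul_mul_rpow_le_young_cw hν4 hβ0 hβ1 hX0 hX20
    have hXpow : X ^ (1 / β) = L ^ (1 / β) * Nl ^ (1 / β) * Yφ := by
      rw [hXdef, Real.mul_rpow (mul_nonneg hL0 hNl0) (Real.rpow_nonneg hYφ0 _),
        Real.mul_rpow hL0 hNl0, ← Real.rpow_mul hYφ0,
        mul_one_div_cancel hβ0.ne', Real.rpow_one]
    have h2G : 2 * ∫ x, Gt x ≤ 2 * X * X2 ^ (1 - β) := by
      have := mul_le_mul_of_nonneg_left hTG1 (by norm_num : (0 : ℝ) ≤ 2)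
      linarith
    have e1 : ν / 4 / 2 * X2 = ν / 4 * D' + ν / 4 * Bφ ^ 2 * Yl := by rw [hX2]; ring
    have e2 : cY * X ^ (1 / β) = (C₅ * NlP) * Yφ := by
      rw [hXpow, hNlγ, hC₅]; ring
    calc 2 * ∫ x, Gt x ≤ 2 * X * X2 ^ (1 - β) := h2G
      _ ≤ ν / 4 / 2 * X2 + cY * X ^ (1 / β) := hy
      _ = ν / 4 * D' + ν / 4 * Bφ ^ 2 * Yl + (C₅ * NlP) * Yφ := by rw [e1, e2]
  -- ### the final count
  have hcount := localized_stretching_count_of_two_mul_high_le (TE := ∫ x, Et x) (TB := ∫ x, Bt x)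
    (TG := ∫ x, Gt x) (σ := σ) (a := a) (El := El) (W := C₅ * NlP) hν hBφ0 hYφ0 hD'0 hFl0
    hS'sq hTE hTB hTG
  have hνD : ν * D' ≤ ν * Dφ := mul_le_mul_of_nonneg_left hD'D hν.le
  rw [hP]
  linarith only [hcount, hνD]

end Literature.Analysis.FluidPDE

end
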